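import Summits.MatrixMultiplication.MatrixMultiplication.Theses.FourierTwoFamiliesModP
import Summits.MatrixMultiplication.MatrixMultiplication.Theses.FourierTwoFamilies
import Literature.Computability.AlgebraicComplexity.SimultaneousDoubleProduct

/-!
# Disproof of `PrimeCyclicPowerGain` (stmt-MatrixMultiplication-14309) — findings

Crux: `∃ c > 0, ∃ s₀, ∀ p prime, ∀ balanced SDPP (n pairs, |A i| = |B i| = s ≥ s₀, (W), (X)) in ZMod p:
n·s^{1+c} ≤ p`, i.e. density `ρ = ns/p ≤ s^{-c}`.  VERDICT SO FAR: **resists** — a refutation needs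
balanced SDPP designs in cyclic groups with density `s^{-o(1)}` (equivalently, CKSU 2005 Prop. 25's
bound `2β ≥ α + 2` tight for balanced families in cyclic hosts), an open construction problem; but the
admissible range of `c` is now machine-bounded: **`c < log(81/28)/log 7 ≈ 0.5459`** (section (c2)).

Index (all `theorem`s below are sorry-free unless marked NEAR-MISS):
* (a) load-bearing analysis —
  `primeCyclicPowerGain_false_without_balanceB` (drop `|B i| = s`: n = 1, B = {0}, Bertrand p ∈ (s,2s]);
  `primeCyclicPowerGain_false_without_W` (drop (W): n = 1, A = B = [0,s));
  `primeCyclicPowerGain_false_without_X` (keep only pairwise disjointness: n = s, A i = is+[0,s),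
  B i = i+s[0,s), density ≥ 1/4);
  `primeCyclicPowerGain_iff_cyclicPowerGain` — primality is NOT load-bearing: the crux ⇔ the same
  bound over all `ZMod N` (`lift_design`: `x ↦ x.val` into `ZMod p`, `p ∈ (2N,4N]`, `c ↦ c/2`);
  `Digit.primeCyclicPowerGain_iff_thresholdFree` — the threshold `s ≥ s₀` is NOT load-bearing either:
  the crux ⇔ `∃ c > 0, n·s^{1+c} ≤ 8p` for ALL balanced SDPP configurations, via
  `Digit.numeration_power` (CKSU Lemma 21 in cyclic form: the `k`-th power of a design in `ZMod p`,
  digits `x.val` in radix `2p`, is a design in `ZMod q`, `q ≥ 2(2p)^k` — a prover/planner tool, e.g.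
  for CyclicReduction stmt-14313 and for amplifying wall breaches).
* (b) structure of witnesses — `translate_wall`: `A i = tᵢ + A₀`, `B i = uᵢ + B₀` with (W),(X) force
  `n·|A₀||B₀| ≤ |G|` in ANY finite abelian group; so witnesses against exponent `1+c` need more than
  `s^{1-c}` distinct shapes.
* (c) natural strengthenings that are FALSE —
  (c1) `not_powerGainAt_of_one_lt`: no exponent `1 + c > 2` (translates, `n = ⌊p/s²⌋`);
  (c2) `Digit.digit_design` + `not_powerGainAt_of_large`: the **radix-`M` digit design**
  `A_S = {Σ_{t∈S} x_t M^t : x_t ∈ [2,M-1]}`, `B_S = {−Σ_{t∉S} y_t M^t}` (`|S| = l` of `2l` digits) is a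
  balanced SDPP family IN THE CYCLIC GROUP (`ZMod p`, `p ≥ 2M^{2l}`; digits `0,1` excluded so the single
  carry into a zero digit cannot fake a `D`-digit) with `n = binom(2l,l)`, `s = (M-2)^l`: density
  `(4(M-2)/M²)^l/√(πl) ≈ s^{-0.546}` at `M = 9` — hence `¬ PowerGainAt c s₀` whenever `81 < 4·7^{1+c}`;
  (c3) `Digit.wallBreachModP` (= route item stmt-14315, positive) and the LANDED refutation
  `Theorems/FourierTwoFamiliesPrimeCyclicWallRefutation.lean` (p69024, ACCEPTED): the wall `c = 1` is false;
  (c4) `Torus.torus_design` (CKSU Prop. 24 in `(ZMod 3)^{2l}`, sorry-free) + `Torus.not_balancedPowerGain_of_large`: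
  the all-abelian power saving fails for `9 < 4·2^{1+c}` (`c > 0.1699`) — the benchmark a cyclic kill must approach.
* (d) targets: none (lead has no stuck stubs yet).
* (e) NEAR-MISS `primeCyclicPowerGain_refuted` (sorried): what a kill still needs.

Dead ends (one line each): Behrend/3-AP blow-ups (inner direct pair costs s², density ≤ 1/s); random or
generic-dilate families (n ≪ √p/s²); multiplicative-coset pairs (no gain over translates); smooth
X, Y (reduces to the local problem); products of small blocks (exponent = average of factors,
≈ -0.78 at best); CRT images of CKSU Prop. 24 (moduli must grow: s^{-1+o(1)} asymptotically);
skew-corner literature (Pratt 2024 / Beker / Pohoata–Zakharov) transfers only SDPP ⇒ skew-corner-free.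
Compute (kit jobs, results pending at writing): exact SAT census of n_max(N,s), s = 3,4; lattice
search for linear cyclic images of CKSU designs (m = 3,4,5; l = 1,2).
-/

set_option linter.dupNamespace false

namespace Summit.MatrixMultiplication.MatrixMultiplication.Cruxes.PrimeCyclicPowerGain.Disproof

open Summit.MatrixMultiplication.MatrixMultiplication.Theses.FourierTwoFamiliesModP
open Finset

/-! ## Named forms of the hypotheses (verbatim binders of the crux) -/

/-- balanced: `|A i| = |B i| = s`. -/
def Balanced {G : Type*} {n : ℕ} (s : ℕ) (A B : Fin n → Finset G) : Prop :=
  ∀ i : Fin n, (A i).card = s ∧ (B i).card = s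

/-- (W): each `A i ⊕ B i` is direct. -/
def CondW {G : Type*} [AddCommGroup G] {n : ℕ} (A B : Fin n → Finset G) : Prop :=
  ∀ i : Fin n, ∀ a ∈ A i, ∀ a' ∈ A i, ∀ b ∈ B i, ∀ b' ∈ B i, (a - a') + (b - b') = 0 → a = a' ∧ b = b'

/-- (X): `(a − a') + (b − b') = 0`, `a ∈ A i, a' ∈ A j, b ∈ B j, b' ∈ B k` forces `i = k`. -/
def CondX {G : Type*} [AddCommGroup G] {n : ℕ} (A B : Fin n → Finset G) : Prop :=
  ∀ i j k : Fin n, ∀ a ∈ A i, ∀ a' ∈ A j, ∀ b ∈ B j, ∀ b' ∈ B k, (a - a') + (b - b') = 0 → i = k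

/-- The crux at a fixed exponent `c` and threshold `s₀`. -/
def PowerGainAt (c : ℝ) (s₀ : ℕ) : Prop :=
  ∀ p : ℕ, p.Prime → ∀ (n s : ℕ) (A B : Fin n → Finset (ZMod p)), s₀ ≤ s → Balanced s A B →
    CondW A B → CondX A B → (n : ℝ) * (s : ℝ) ^ (1 + c) ≤ (p : ℝ)

theorem primeCyclicPowerGain_iff :
    PrimeCyclicPowerGain ↔ ∃ c : ℝ, 0 < c ∧ ∃ s₀ : ℕ, PowerGainAt c s₀ := Iff.rfl

/-! ## Infrastructure: small naturals inside `ZMod p` -/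

lemma nat_eq_of_cast_eq {p x y : ℕ} (hx : x < p) (hy : y < p)
    (h : ((x : ℕ) : ZMod p) = ((y : ℕ) : ZMod p)) : x = y := by
  have := (ZMod.natCast_eq_natCast_iff' x y p).mp h
  rwa [Nat.mod_eq_of_lt hx, Nat.mod_eq_of_lt hy] at this

/-- From `(a − a') + (b − b') = 0` in `ZMod p` to `a + b = a' + b'` in `ℕ`, when all sums are `< p`. -/
lemma nat_add_eq_of_sub_add_sub_eq_zero {p xa xa' xb xb' : ℕ} (h1 : xa + xb < p) (h2 : xa' + xb' < p)
    (h : ((xa : ZMod p) - (xa' : ZMod p)) + ((xb : ZMod p) - (xb' : ZMod p)) = 0) :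
    xa + xb = xa' + xb' := by
  rw [sub_add_sub_comm, sub_eq_zero] at h
  apply nat_eq_of_cast_eq h1 h2
  push_cast
  exact h

/-- Image of a finset of naturals `< p` in `ZMod p` has the same cardinality. -/
lemma card_image_natCast {p : ℕ} (S : Finset ℕ) (h : ∀ x ∈ S, x < p) :
    (S.image (fun x : ℕ => (x : ZMod p))).card = S.card := by
  apply Finset.card_image_of_injOn
  intro x hx y hy hxy
  exact nat_eq_of_cast_eq (h x hx) (h y hy) hxy

/-! ## (a) Load-bearing analysis, part 1: balance of `B` -/

/-- The crux with the cardinality condition on the `B i` dropped (only `|A i| = s` kept). -/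
def PrimeCyclicPowerGainWithoutBalanceB : Prop :=
  ∃ c : ℝ, 0 < c ∧ ∃ s₀ : ℕ, ∀ p : ℕ, p.Prime → ∀ (n s : ℕ) (A B : Fin n → Finset (ZMod p)), s₀ ≤ s →
    (∀ i : Fin n, (A i).card = s) → CondW A B → CondX A B → (n : ℝ) * (s : ℝ) ^ (1 + c) ≤ (p : ℝ)

/-- Any proof must use `|B i| = s`: with `n = 1`, `A = [0,s)`, `B = {0}` and a Bertrand prime
`p ∈ (s, 2s]`, (W) and (X) hold but `s^{1+c} > 2s ≥ p` as soon as `s^c > 2`. -/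
theorem primeCyclicPowerGain_false_without_balanceB : ¬ PrimeCyclicPowerGainWithoutBalanceB := by
  rintro ⟨c, hc, s₀, h⟩
  -- choose s ≥ s₀ with s^c > 2 : s := max s₀ (⌈2^(1/c)⌉₊ + 1)
  set s : ℕ := max (max s₀ 1) (⌈(2 : ℝ) ^ (c⁻¹)⌉₊ + 1) with hs_def
  have hs₀ : s₀ ≤ s := le_trans (le_max_left _ _) (le_max_left _ _)
  have hs1 : 1 ≤ s := le_trans (le_max_right _ _) (le_max_left _ _)
  have hs_pos : (0 : ℝ) < s := by exact_mod_cast hs1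
  have hsc : (2 : ℝ) < (s : ℝ) ^ c := by
    have h1 : (2 : ℝ) ^ (c⁻¹) < s := by
      have : (⌈(2 : ℝ) ^ (c⁻¹)⌉₊ + 1 : ℕ) ≤ s := le_max_right _ _
      have h2 : (2 : ℝ) ^ (c⁻¹) ≤ ⌈(2 : ℝ) ^ (c⁻¹)⌉₊ := Nat.le_ceil _
      calc (2 : ℝ) ^ (c⁻¹) ≤ ⌈(2 : ℝ) ^ (c⁻¹)⌉₊ := h2
        _ < (⌈(2 : ℝ) ^ (c⁻¹)⌉₊ : ℝ) + 1 := by linarith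
        _ = ((⌈(2 : ℝ) ^ (c⁻¹)⌉₊ + 1 : ℕ) : ℝ) := by push_cast; ring
        _ ≤ s := by exact_mod_cast this
    have h3 : ((2 : ℝ) ^ (c⁻¹)) ^ c < (s : ℝ) ^ c :=
      Real.rpow_lt_rpow (by positivity) h1 hc
    rwa [Real.rpow_inv_rpow (by norm_num) hc.ne'] at h3
  -- Bertrand prime p with s < p ≤ 2 s
  obtain ⟨p, hp, hsp, hp2s⟩ := Nat.exists_prime_lt_and_le_two_mul s (by omega)
  -- the configuration
  let A : Fin 1 → Finset (ZMod p) := fun _ => (Finset.range s).image (fun x : ℕ => (x : ZMod p))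
  let B : Fin 1 → Finset (ZMod p) := fun _ => {0}
  have hA : ∀ i : Fin 1, (A i).card = s := by
    intro i
    show ((Finset.range s).image (fun x : ℕ => (x : ZMod p))).card = s
    rw [card_image_natCast _ (fun x hx => lt_trans (Finset.mem_range.mp hx) hsp), Finset.card_range]
  have hW : CondW A B := by
    intro i a ha a' ha' b hb b' hb'
    simp only [B, Finset.mem_singleton] at hb hb'
    subst hb; subst hb'
    intro hab
    refine ⟨?_, rfl⟩
    simpa [sub_eq_zero] using hab
  have hX : CondX A B := by
    intro i j k _ _ _ _ _ _ _ _ _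
    exact Subsingleton.elim i k
  have key := h p hp 1 s A B hs₀ hA hW hX
  -- contradiction: 1 * s^(1+c) = s * s^c > 2 s ≥ p
  have hp_le : (p : ℝ) ≤ 2 * s := by exact_mod_cast hp2s
  have : (s : ℝ) ^ (1 + c) = s * (s : ℝ) ^ c := by
    rw [Real.rpow_add hs_pos, Real.rpow_one]
  have key' : (s : ℝ) * (s : ℝ) ^ c ≤ p := by simpa [this] using key
  nlinarith [mul_lt_mul_of_pos_left hsc hs_pos]

/-! ## (a) Load-bearing analysis, part 2: the directness condition (W) -/

/-- The crux with (W) dropped. -/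
def PrimeCyclicPowerGainWithoutW : Prop :=
  ∃ c : ℝ, 0 < c ∧ ∃ s₀ : ℕ, ∀ p : ℕ, p.Prime → ∀ (n s : ℕ) (A B : Fin n → Finset (ZMod p)), s₀ ≤ s →
    Balanced s A B → CondX A B → (n : ℝ) * (s : ℝ) ^ (1 + c) ≤ (p : ℝ)

/-- choosing a large `s`: for `c > 0`, `K ≥ 0` and any `s₀` there is `s ≥ max s₀ 1` with `K < s ^ c`. -/
lemma exists_nat_rpow_gt (c K : ℝ) (hc : 0 < c) (hK : 0 ≤ K) (s₀ : ℕ) :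
    ∃ s : ℕ, s₀ ≤ s ∧ 1 ≤ s ∧ K < (s : ℝ) ^ c := by
  refine ⟨max (max s₀ 1) (⌈K ^ (c⁻¹)⌉₊ + 1), le_trans (le_max_left _ _) (le_max_left _ _),
    le_trans (le_max_right _ _) (le_max_left _ _), ?_⟩
  set s : ℕ := max (max s₀ 1) (⌈K ^ (c⁻¹)⌉₊ + 1)
  have h1 : K ^ (c⁻¹) < s := by
    have : (⌈K ^ (c⁻¹)⌉₊ + 1 : ℕ) ≤ s := le_max_right _ _
    calc K ^ (c⁻¹) ≤ ⌈K ^ (c⁻¹)⌉₊ := Nat.le_ceil _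
      _ < (⌈K ^ (c⁻¹)⌉₊ : ℝ) + 1 := by linarith
      _ = ((⌈K ^ (c⁻¹)⌉₊ + 1 : ℕ) : ℝ) := by push_cast; ring
      _ ≤ s := by exact_mod_cast this
  have h3 : (K ^ (c⁻¹)) ^ c < (s : ℝ) ^ c := Real.rpow_lt_rpow (by positivity) h1 hc
  rwa [Real.rpow_inv_rpow hK hc.ne'] at h3

/-- Any proof must use (W): with `n = 1`, `A = B = [0,s)` and a Bertrand prime `p ∈ (s, 2s]`,
(X) holds trivially (one index) but `s^{1+c} > 2s ≥ p` once `s^c > 2`.  (Without (W) nothing ties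
`s` to `p`; (W) is what gives `s² ≤ p`.) -/
theorem primeCyclicPowerGain_false_without_W : ¬ PrimeCyclicPowerGainWithoutW := by
  rintro ⟨c, hc, s₀, h⟩
  obtain ⟨s, hs₀, hs1, hsc⟩ := exists_nat_rpow_gt c 2 hc (by norm_num) s₀
  have hs_pos : (0 : ℝ) < s := by exact_mod_cast hs1
  obtain ⟨p, hp, hsp, hp2s⟩ := Nat.exists_prime_lt_and_le_two_mul s (by omega)
  let A : Fin 1 → Finset (ZMod p) := fun _ => (Finset.range s).image (fun x : ℕ => (x : ZMod p))
  have hA : Balanced s A A := by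
    intro i
    have : ((Finset.range s).image (fun x : ℕ => (x : ZMod p))).card = s := by
      rw [card_image_natCast _ (fun x hx => lt_trans (Finset.mem_range.mp hx) hsp), Finset.card_range]
    exact ⟨this, this⟩
  have hX : CondX A A := fun i j k _ _ _ _ _ _ _ _ _ => Subsingleton.elim i k
  have key := h p hp 1 s A A hs₀ hA hX
  have hp_le : (p : ℝ) ≤ 2 * s := by exact_mod_cast hp2s
  have : (s : ℝ) ^ (1 + c) = s * (s : ℝ) ^ c := by rw [Real.rpow_add hs_pos, Real.rpow_one]
  have key' : (s : ℝ) * (s : ℝ) ^ c ≤ p := by simpa [this] using key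
  nlinarith [mul_lt_mul_of_pos_left hsc hs_pos]

/-! ## (a) Load-bearing analysis, part 3: the cross condition (X) beyond disjointness -/

/-- The crux with (X) weakened to its two trivial consequences: the `A i` are pairwise disjoint and
so are the `B i` (take `j = k`, resp. `i = j`, in (X)). -/
def PrimeCyclicPowerGainWithoutX : Prop :=
  ∃ c : ℝ, 0 < c ∧ ∃ s₀ : ℕ, ∀ p : ℕ, p.Prime → ∀ (n s : ℕ) (A B : Fin n → Finset (ZMod p)), s₀ ≤ s →
    Balanced s A B → CondW A B →
    (∀ i k : Fin n, i ≠ k → Disjoint (A i) (A k) ∧ Disjoint (B i) (B k)) →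
    (n : ℝ) * (s : ℝ) ^ (1 + c) ≤ (p : ℝ)

lemma aux_lt1 {i t s : ℕ} (hi : i < s) (ht : t < s) : i * s + t < s * s :=
  calc i * s + t < i * s + s := by omega
    _ = (i + 1) * s := by ring
    _ ≤ s * s := Nat.mul_le_mul_right s hi

lemma aux_lt2 {i t s : ℕ} (hi : i < s) (ht : t < s) : i + s * t < s * s :=
  calc i + s * t < s + s * t := by omega
    _ = s * (t + 1) := by ring
    _ ≤ s * s := Nat.mul_le_mul_left s ht

/-- base-`s` digits: `t₁ + s·t₃ = t₂ + s·t₄` with `t₁, t₂ < s` forces `t₁ = t₂` and `t₃ = t₄`. -/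
lemma digits_inj {s t₁ t₂ t₃ t₄ : ℕ} (h1 : t₁ < s) (h2 : t₂ < s) (h : t₁ + s * t₃ = t₂ + s * t₄) :
    t₁ = t₂ ∧ t₃ = t₄ := by
  have hs : 0 < s := by omega
  have hmod := congrArg (· % s) h
  simp only [Nat.add_mul_mod_self_left, Nat.mod_eq_of_lt h1, Nat.mod_eq_of_lt h2] at hmod
  subst hmod
  refine ⟨rfl, ?_⟩
  have : s * t₃ = s * t₄ := by omega
  exact Nat.eq_of_mul_eq_mul_left hs this

/-- Any proof must use the genuinely three-index part of (X): with only (W) + pairwise disjointness,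
`n = s` pairs `A i = i·s + [0,s)`, `B i = i + s·[0,s)` (so `X = Y = [0,s²)`, `A i ⊕ B i` direct by
base-`s` digits) live in `ZMod p` for a Bertrand prime `p ∈ (2s², 4s²]`: density `≥ 1/4`, and
`n·s^{1+c} = s²·s^c > 4s² ≥ p` once `s^c > 4`. -/
theorem primeCyclicPowerGain_false_without_X : ¬ PrimeCyclicPowerGainWithoutX := by
  rintro ⟨c, hc, s₀, h⟩
  obtain ⟨s, hs₀, hs1, hsc⟩ := exists_nat_rpow_gt c 4 hc (by norm_num) s₀
  have hs_pos : (0 : ℝ) < s := by exact_mod_cast hs1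
  obtain ⟨p, hp, hsp, hp2s⟩ := Nat.exists_prime_lt_and_le_two_mul (2 * (s * s)) (by positivity)
  let A : Fin s → Finset (ZMod p) := fun i => (Finset.range s).image (fun t : ℕ => ((i.val * s + t : ℕ) : ZMod p))
  let B : Fin s → Finset (ZMod p) := fun i => (Finset.range s).image (fun t : ℕ => ((i.val + s * t : ℕ) : ZMod p))
  -- all elements are naturals < s*s < p
  have hbdA : ∀ (i : Fin s) (t : ℕ), t < s → i.val * s + t < s * s := fun i t ht => aux_lt1 i.isLt ht
  have hbdB : ∀ (i : Fin s) (t : ℕ), t < s → i.val + s * t < s * s := fun i t ht => aux_lt2 i.isLt ht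
  have hssp : s * s < p := by omega
  have hbal : Balanced s A B := by
    intro i
    constructor
    · show ((Finset.range s).image _).card = s
      rw [Finset.card_image_of_injOn, Finset.card_range]
      intro t ht t' ht' htt
      have := nat_eq_of_cast_eq (lt_trans (hbdA i t (Finset.mem_range.mp ht)) hssp)
        (lt_trans (hbdA i t' (Finset.mem_range.mp ht')) hssp) htt
      omega
    · show ((Finset.range s).image _).card = s
      rw [Finset.card_image_of_injOn, Finset.card_range]
      intro t ht t' ht' htt
      have := nat_eq_of_cast_eq (lt_trans (hbdB i t (Finset.mem_range.mp ht)) hssp)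
        (lt_trans (hbdB i t' (Finset.mem_range.mp ht')) hssp) htt
      have hs0 : 0 < s := by omega
      have : s * t = s * t' := by omega
      exact Nat.eq_of_mul_eq_mul_left hs0 this
  have hW : CondW A B := by
    intro i a ha a' ha' b hb b' hb' hab
    simp only [A, B, Finset.mem_image, Finset.mem_range] at ha ha' hb hb'
    obtain ⟨t₁, ht₁, rfl⟩ := ha
    obtain ⟨t₂, ht₂, rfl⟩ := ha'
    obtain ⟨t₃, ht₃, rfl⟩ := hb
    obtain ⟨t₄, ht₄, rfl⟩ := hb'
    have hnat := nat_add_eq_of_sub_add_sub_eq_zero (by have := hbdA i t₁ ht₁; have := hbdB i t₃ ht₃; omega)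
      (by have := hbdA i t₂ ht₂; have := hbdB i t₄ ht₄; omega) hab
    have h' : t₁ + s * t₃ = t₂ + s * t₄ := by omega
    obtain ⟨rfl, rfl⟩ := digits_inj ht₁ ht₂ h'
    exact ⟨rfl, rfl⟩
  have hD : ∀ i k : Fin s, i ≠ k → Disjoint (A i) (A k) ∧ Disjoint (B i) (B k) := by
    intro i k hik
    constructor
    · rw [Finset.disjoint_left]
      intro x hx hx'
      simp only [A, Finset.mem_image, Finset.mem_range] at hx hx'
      obtain ⟨t, ht, rfl⟩ := hx
      obtain ⟨t', ht', he⟩ := hx'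
      have hnat := nat_eq_of_cast_eq (lt_trans (hbdA k t' ht') hssp) (lt_trans (hbdA i t ht) hssp) he
      have h' : t' + s * k.val = t + s * i.val := by rw [mul_comm s, mul_comm s]; omega
      obtain ⟨-, hki⟩ := digits_inj ht' ht h'
      exact hik (Fin.ext hki.symm)
    · rw [Finset.disjoint_left]
      intro x hx hx'
      simp only [B, Finset.mem_image, Finset.mem_range] at hx hx'
      obtain ⟨t, ht, rfl⟩ := hx
      obtain ⟨t', ht', he⟩ := hx'
      have hnat := nat_eq_of_cast_eq (lt_trans (hbdB k t' ht') hssp) (lt_trans (hbdB i t ht) hssp) he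
      obtain ⟨hki, -⟩ := digits_inj k.isLt i.isLt hnat
      exact hik (Fin.ext hki.symm)
  have key := h p hp s s A B hs₀ hbal hW hD
  have hp_le : (p : ℝ) ≤ 4 * (s * s) := by exact_mod_cast (by omega : p ≤ 4 * (s * s))
  have : (s : ℝ) ^ (1 + c) = s * (s : ℝ) ^ c := by rw [Real.rpow_add hs_pos, Real.rpow_one]
  rw [this] at key
  have hss : (0 : ℝ) < s * s := by positivity
  nlinarith [mul_lt_mul_of_pos_left hsc hss]

/-! ## (a) Load-bearing analysis, part 4: primality of the modulus is NOT load-bearing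

Designs transfer from any cyclic group `ZMod N` to `ZMod p` for every `p ≥ 2N` (send `x ↦ x.val`):
a relation `(a − a') + (b − b') = 0` in `ZMod p` between images forces `a.val + b.val = a'.val + b'.val`
in `ℕ` (both sides `< 2N ≤ p`), hence the same relation in `ZMod N`.  With a Bertrand prime
`p ∈ (2N, 4N]` this shows `PrimeCyclicPowerGain ↔ CyclicPowerGain` (the factor `4` is absorbed by
halving `c`).  Consequences: a prover may as well work in arbitrary `ZMod N`; a disprover may search
composite moduli (CRT hosts `ZMod (m₁⋯m_k)`), losing only the constant `4`. -/

/-- transfer of a design along `ZMod N → ZMod p`, `x ↦ x.val`, for `p ≥ 2N`. -/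
theorem lift_design {N : ℕ} (hN : 0 < N) {n s : ℕ} (A B : Fin n → Finset (ZMod N))
    (hbal : Balanced s A B) (hW : CondW A B) (hX : CondX A B) {p : ℕ} (hp : 2 * N ≤ p) :
    ∃ A' B' : Fin n → Finset (ZMod p), Balanced s A' B' ∧ CondW A' B' ∧ CondX A' B' := by
  haveI : NeZero N := ⟨hN.ne'⟩
  let f : ZMod N → ZMod p := fun x => ((x.val : ℕ) : ZMod p)
  have hf_inj : Function.Injective f := by
    intro x y hxy
    have := nat_eq_of_cast_eq (lt_of_lt_of_le (ZMod.val_lt x) (by omega))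
      (lt_of_lt_of_le (ZMod.val_lt y) (by omega)) hxy
    exact ZMod.val_injective N this
  -- the key transfer of one relation
  have transfer : ∀ x x' z z' : ZMod N, (f x - f x') + (f z - f z') = 0 → (x - x') + (z - z') = 0 := by
    intro x x' z z' h
    have hnat := nat_add_eq_of_sub_add_sub_eq_zero
      (by have := ZMod.val_lt x; have := ZMod.val_lt z; omega)
      (by have := ZMod.val_lt x'; have := ZMod.val_lt z'; omega) h
    have hc := congrArg (fun m : ℕ => (m : ZMod N)) hnat
    simp only [Nat.cast_add, ZMod.natCast_val, ZMod.cast_id', id_eq] at hc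
    rw [sub_add_sub_comm, sub_eq_zero]
    exact hc
  refine ⟨fun i => (A i).image f, fun i => (B i).image f, ?_, ?_, ?_⟩
  · intro i
    simp only [Finset.card_image_of_injective _ hf_inj]
    exact hbal i
  · intro i a ha a' ha' b hb b' hb' hab
    simp only [Finset.mem_image] at ha ha' hb hb'
    obtain ⟨x, hx, rfl⟩ := ha
    obtain ⟨x', hx', rfl⟩ := ha'
    obtain ⟨z, hz, rfl⟩ := hb
    obtain ⟨z', hz', rfl⟩ := hb'
    obtain ⟨h1, h2⟩ := hW i x hx x' hx' z hz z' hz' (transfer x x' z z' hab)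
    exact ⟨by rw [h1], by rw [h2]⟩
  · intro i j k a ha a' ha' b hb b' hb' hab
    simp only [Finset.mem_image] at ha ha' hb hb'
    obtain ⟨x, hx, rfl⟩ := ha
    obtain ⟨x', hx', rfl⟩ := ha'
    obtain ⟨z, hz, rfl⟩ := hb
    obtain ⟨z', hz', rfl⟩ := hb'
    exact hX i j k x hx x' hx' z hz z' hz' (transfer x x' z z' hab)

/-- The crux over all cyclic groups `ZMod N`, `N ≥ 1` (primality dropped). -/
def CyclicPowerGain : Prop :=
  ∃ c : ℝ, 0 < c ∧ ∃ s₀ : ℕ, ∀ N : ℕ, 0 < N → ∀ (n s : ℕ) (A B : Fin n → Finset (ZMod N)), s₀ ≤ s →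
    Balanced s A B → CondW A B → CondX A B → (n : ℝ) * (s : ℝ) ^ (1 + c) ≤ (N : ℝ)

/-- thresholds: for `s ≥ ⌈K^{1/c}⌉₊` we have `K ≤ s^c`. -/
lemma le_rpow_of_ceil_le {c K : ℝ} (hc : 0 < c) (hK : 0 ≤ K) {s : ℕ} (hs : ⌈K ^ (c⁻¹)⌉₊ ≤ s) :
    K ≤ (s : ℝ) ^ c := by
  have h1 : K ^ (c⁻¹) ≤ s := le_trans (Nat.le_ceil _) (by exact_mod_cast hs)
  have h2 : (K ^ (c⁻¹)) ^ c ≤ (s : ℝ) ^ c := Real.rpow_le_rpow (by positivity) h1 hc.le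
  rwa [Real.rpow_inv_rpow hK hc.ne'] at h2

/-- `p.Prime` is not load-bearing: the crux is equivalent to its version over all cyclic groups. -/
theorem primeCyclicPowerGain_iff_cyclicPowerGain : PrimeCyclicPowerGain ↔ CyclicPowerGain := by
  constructor
  · rintro ⟨c, hc, s₀, h⟩
    have hc2 : 0 < c / 2 := by linarith
    refine ⟨c / 2, hc2, max s₀ (⌈(4 : ℝ) ^ ((c / 2)⁻¹)⌉₊), ?_⟩
    intro N hN n s A B hs hbal hW hX
    have hs₀ : s₀ ≤ s := le_trans (le_max_left _ _) hs
    have h4 : (4 : ℝ) ≤ (s : ℝ) ^ (c / 2) :=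
      le_rpow_of_ceil_le hc2 (by norm_num) (le_trans (le_max_right _ _) hs)
    obtain ⟨p, hp, hNp, hp4N⟩ := Nat.exists_prime_lt_and_le_two_mul (2 * N) (by omega)
    obtain ⟨A', B', hbal', hW', hX'⟩ := lift_design hN A B hbal hW hX (le_of_lt hNp)
    have key := h p hp n s A' B' hs₀ hbal' hW' hX'
    have hp_le : (p : ℝ) ≤ 4 * N := by exact_mod_cast (by omega : p ≤ 4 * N)
    have hs_pos : (0 : ℝ) < s := by
      have : (0 : ℝ) < (s : ℝ) ^ (c / 2) := by linarith
      rcases Nat.eq_zero_or_pos s with h0 | h0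
      · subst h0; simp [Real.zero_rpow hc2.ne'] at this
      · exact_mod_cast h0
    have hsplit : (s : ℝ) ^ (1 + c) = (s : ℝ) ^ (1 + c / 2) * (s : ℝ) ^ (c / 2) := by
      rw [← Real.rpow_add hs_pos]; ring_nf
    rw [hsplit] at key
    have hx : 0 ≤ (n : ℝ) * (s : ℝ) ^ (1 + c / 2) := by positivity
    -- x * y ≤ 4N with y ≥ 4 ⇒ x ≤ N
    nlinarith [mul_le_mul_of_nonneg_left h4 hx]
  · rintro ⟨c, hc, s₀, h⟩
    exact ⟨c, hc, s₀, fun p hp n s A B hs hbal hW hX => h p hp.pos n s A B hs hbal hW hX⟩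

/-! ## (b) Structure of would-be counterexamples: translate families obey the wall `n·s² ≤ |G|`

If all pairs are translates of one pair, `A i = tᵢ + A₀`, `B i = uᵢ + B₀` (the second shifts `uᵢ`
arbitrary), then (W)+(X) force `(i, a, b) ↦ tᵢ + a + b` to be injective on `Fin n × A₀ × B₀`
((X) at `(i, k, k)` gives `i = k`, then (W) gives `a = a'`, `b = b'`), so `n·|A₀|·|B₀| ≤ |G|`.
Hence translate families satisfy the conclusion of the crux for every `c ≤ 1`; by pigeonhole a family
using at most `m` translation classes of pairs has `n·s² ≤ m·p`, so a witness against exponent `1+c`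
needs more than `s^{1-c}` distinct shapes `(A i − min, B i − min)`. -/

theorem translate_wall {G : Type*} [AddCommGroup G] [Fintype G] [DecidableEq G] {n : ℕ}
    (A₀ B₀ : Finset G) (t u : Fin n → G)
    (hW : CondW (fun i => A₀.image (· + t i)) (fun i => B₀.image (· + u i)))
    (hX : CondX (fun i => A₀.image (· + t i)) (fun i => B₀.image (· + u i))) :
    n * (A₀.card * B₀.card) ≤ Fintype.card G := by
  classical
  let Φ : Fin n × (A₀ × B₀) → G := fun q => t q.1 + q.2.1.val + q.2.2.val
  have hΦ : Function.Injective Φ := by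
    rintro ⟨i, ⟨a, ha⟩, ⟨b, hb⟩⟩ ⟨k, ⟨a', ha'⟩, ⟨b', hb'⟩⟩ he
    simp only [Φ] at he
    -- (X) at indices (i, k, k) with a_i = a + t i, a'_k = a' + t k, b_k = b + u k, b'_k = b' + u k
    have hik : i = k := by
      refine hX i k k (a + t i) ?_ (a' + t k) ?_ (b + u k) ?_ (b' + u k) ?_ ?_
      · exact Finset.mem_image.mpr ⟨a, ha, rfl⟩
      · exact Finset.mem_image.mpr ⟨a', ha', rfl⟩
      · exact Finset.mem_image.mpr ⟨b, hb, rfl⟩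
      · exact Finset.mem_image.mpr ⟨b', hb', rfl⟩
      · have : t i + a + b - (t k + a' + b') = 0 := sub_eq_zero.mpr he
        rw [← this]; abel
    subst hik
    have hab : a + b = a' + b' := by
      have := he; rw [add_assoc, add_assoc] at this; exact add_left_cancel this
    obtain ⟨h1, h2⟩ := hW i (a + t i) (Finset.mem_image.mpr ⟨a, ha, rfl⟩) (a' + t i)
      (Finset.mem_image.mpr ⟨a', ha', rfl⟩) (b + u i) (Finset.mem_image.mpr ⟨b, hb, rfl⟩)
      (b' + u i) (Finset.mem_image.mpr ⟨b', hb', rfl⟩)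
      (by
        rw [sub_add_sub_comm, sub_eq_zero]
        calc a + t i + (b + u i) = (a + b) + (t i + u i) := by abel
          _ = (a' + b') + (t i + u i) := by rw [hab]
          _ = a' + t i + (b' + u i) := by abel)
    have h1' : a = a' := add_right_cancel h1
    have h2' : b = b' := add_right_cancel h2
    subst h1'; subst h2'; rfl
  have := Fintype.card_le_of_injective Φ hΦ
  simpa [Fintype.card_prod, Fintype.card_fin, Fintype.card_coe] using this

/-! ## (c) Natural strengthenings that are FALSE

### (c1) the exponent cannot exceed 2: `¬ PowerGainAt c s₀` for every `c > 1`
Translates `A i = s²·i + [0,s)`, `B i = s²·i + s·[0,s)` (`i < s`, base-`s` digits) form a balanced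
SDPP family with `n = s` in `ZMod p` for a Bertrand prime `p ∈ (2s³, 4s³]`; then
`n·s^{1+c} = s³·s^{c-1} > 4s³ ≥ p` once `s^{c-1} > 4`.  (The wall `c = 1` itself is breached only by
non-translate designs — CRT images of CKSU Prop. 4.5, route item WallBreachModP — by `translate_wall`.) -/

lemma aux_lt3 {s i t : ℕ} (hi : i < s) (ht : t < s) : s * s * i + t < s * s * s := by
  have hs : 1 ≤ s := by omega
  calc s * s * i + t < s * s * i + s * s := by nlinarith
    _ = s * s * (i + 1) := by ring
    _ ≤ s * s * s := Nat.mul_le_mul_left _ hi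

lemma aux_lt4 {s i t : ℕ} (hi : i < s) (ht : t < s) : s * s * i + s * t < s * s * s := by
  have h1 : s * t < s * s := Nat.mul_lt_mul_of_pos_left ht (by omega)
  calc s * s * i + s * t < s * s * i + s * s := by omega
    _ = s * s * (i + 1) := by ring
    _ ≤ s * s * s := Nat.mul_le_mul_left _ hi

/-- the translate family used for (c1): `A i = s²i + [0,s)`, `B i = s²i + s[0,s)` in `ZMod p`. -/
def trA (p s : ℕ) (i : Fin s) : Finset (ZMod p) :=
  (Finset.range s).image (fun t : ℕ => ((s * s * i.val + t : ℕ) : ZMod p))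
/-- see `trA`. -/
def trB (p s : ℕ) (i : Fin s) : Finset (ZMod p) :=
  (Finset.range s).image (fun t : ℕ => ((s * s * i.val + s * t : ℕ) : ZMod p))

lemma tr_sdpp {p s : ℕ} (hp : 2 * (s * s * s) < p) :
    Balanced s (trA p s) (trB p s) ∧ CondW (trA p s) (trB p s) ∧ CondX (trA p s) (trB p s) := by
  have hsp : s * s * s < p := by omega
  have bdA : ∀ (i : Fin s) (t : ℕ), t < s → s * s * i.val + t < p :=
    fun i t ht => lt_trans (aux_lt3 i.isLt ht) hsp
  have bdB : ∀ (i : Fin s) (t : ℕ), t < s → s * s * i.val + s * t < p :=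
    fun i t ht => lt_trans (aux_lt4 i.isLt ht) hsp
  -- the common digit argument: from the ℕ-equation to `t₁ = t₂ ∧ t₃ = t₄ ∧ i = k`
  have digit3 : ∀ (i j k : Fin s) (t₁ t₂ t₃ t₄ : ℕ), t₁ < s → t₂ < s → t₃ < s → t₄ < s →
      (s * s * i.val + t₁) + (s * s * j.val + s * t₃) = (s * s * j.val + t₂) + (s * s * k.val + s * t₄) →
      t₁ = t₂ ∧ t₃ = t₄ ∧ i = k := by
    intro i j k t₁ t₂ t₃ t₄ h1 h2 h3 h4 h
    have h' : t₁ + s * (t₃ + s * i.val) = t₂ + s * (t₄ + s * k.val) := by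
      have : (s * s * i.val + t₁) + s * t₃ = (s * s * k.val + t₂) + s * t₄ := by omega
      calc t₁ + s * (t₃ + s * i.val) = (s * s * i.val + t₁) + s * t₃ := by ring
        _ = (s * s * k.val + t₂) + s * t₄ := this
        _ = t₂ + s * (t₄ + s * k.val) := by ring
    obtain ⟨h12, h''⟩ := digits_inj h1 h2 h'
    obtain ⟨h34, hik⟩ := digits_inj h3 h4 h''
    exact ⟨h12, h34, Fin.ext hik⟩
  refine ⟨?_, ?_, ?_⟩
  · intro i
    constructor
    · show ((Finset.range s).image _).card = s
      rw [Finset.card_image_of_injOn, Finset.card_range]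
      intro t ht t' ht' htt
      have := nat_eq_of_cast_eq (bdA i t (Finset.mem_range.mp ht)) (bdA i t' (Finset.mem_range.mp ht')) htt
      omega
    · show ((Finset.range s).image _).card = s
      rw [Finset.card_image_of_injOn, Finset.card_range]
      intro t ht t' ht' htt
      have := nat_eq_of_cast_eq (bdB i t (Finset.mem_range.mp ht)) (bdB i t' (Finset.mem_range.mp ht')) htt
      exact Nat.eq_of_mul_eq_mul_left i.pos (by omega : s * t = s * t')
  · intro i a ha a' ha' b hb b' hb' hab
    simp only [trA, trB, Finset.mem_image, Finset.mem_range] at ha ha' hb hb'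
    obtain ⟨t₁, ht₁, rfl⟩ := ha
    obtain ⟨t₂, ht₂, rfl⟩ := ha'
    obtain ⟨t₃, ht₃, rfl⟩ := hb
    obtain ⟨t₄, ht₄, rfl⟩ := hb'
    have hnat := nat_add_eq_of_sub_add_sub_eq_zero
      (by have := aux_lt3 i.isLt ht₁; have := aux_lt4 i.isLt ht₃; omega)
      (by have := aux_lt3 i.isLt ht₂; have := aux_lt4 i.isLt ht₄; omega) hab
    obtain ⟨rfl, rfl, -⟩ := digit3 i i i t₁ t₂ t₃ t₄ ht₁ ht₂ ht₃ ht₄ hnat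
    exact ⟨rfl, rfl⟩
  · intro i j k a ha a' ha' b hb b' hb' hab
    simp only [trA, trB, Finset.mem_image, Finset.mem_range] at ha ha' hb hb'
    obtain ⟨t₁, ht₁, rfl⟩ := ha
    obtain ⟨t₂, ht₂, rfl⟩ := ha'
    obtain ⟨t₃, ht₃, rfl⟩ := hb
    obtain ⟨t₄, ht₄, rfl⟩ := hb'
    have hnat := nat_add_eq_of_sub_add_sub_eq_zero
      (by have := aux_lt3 i.isLt ht₁; have := aux_lt4 j.isLt ht₃; omega)
      (by have := aux_lt3 j.isLt ht₂; have := aux_lt4 k.isLt ht₄; omega) hab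
    exact (digit3 i j k t₁ t₂ t₃ t₄ ht₁ ht₂ ht₃ ht₄ hnat).2.2

/-- (c1) the exponent `1 + c` of the crux cannot exceed `2`. -/
theorem not_powerGainAt_of_one_lt {c : ℝ} (hc : 1 < c) (s₀ : ℕ) : ¬ PowerGainAt c s₀ := by
  intro h
  obtain ⟨s, hs₀, hs1, hsc⟩ := exists_nat_rpow_gt (c - 1) 4 (by linarith) (by norm_num) s₀
  have hs_pos : (0 : ℝ) < s := by exact_mod_cast hs1
  obtain ⟨p, hp, hsp, hp2⟩ := Nat.exists_prime_lt_and_le_two_mul (2 * (s * s * s)) (by positivity)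
  obtain ⟨hbal, hW, hX⟩ := tr_sdpp (p := p) (s := s) hsp
  have key := h p hp s s (trA p s) (trB p s) hs₀ hbal hW hX
  have hp_le : (p : ℝ) ≤ 4 * (s * s * s) := by exact_mod_cast (by omega : p ≤ 4 * (s * s * s))
  have hsplit : (s : ℝ) ^ (1 + c) = (s * s) * (s : ℝ) ^ (c - 1) := by
    have : (1 + c) = 2 + (c - 1) := by ring
    rw [this, Real.rpow_add hs_pos, Real.rpow_two]; ring
  rw [hsplit] at key
  have hsss : (0 : ℝ) < s * (s * s) := by positivity
  nlinarith [mul_lt_mul_of_pos_left hsc hsss]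


/-! ## (c2)/(c3) The radix-`M` digit design (densest known cyclic SDPP family) -/

namespace Digit

open Finset

/-- digit sums: `dsum M f k = Σ_{t<k} f t * M^t`. -/
def dsum (M : ℕ) (f : ℕ → ℕ) (k : ℕ) : ℕ := ∑ t ∈ range k, f t * M ^ t

lemma dsum_succ (M : ℕ) (f : ℕ → ℕ) (k : ℕ) : dsum M f (k + 1) = dsum M f k + f k * M ^ k := by
  simp [dsum, sum_range_succ]

lemma dsum_zero (M : ℕ) (f : ℕ → ℕ) : dsum M f 0 = 0 := by simp [dsum]

/-- digits `≤ M-1` ⇒ `dsum < M^k` (needs `1 ≤ M`). -/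
lemma dsum_lt_pow {M : ℕ} (hM : 1 ≤ M) (f : ℕ → ℕ) (k : ℕ) (hf : ∀ t < k, f t ≤ M - 1) :
    dsum M f k < M ^ k := by
  induction k with
  | zero => simp [dsum]
  | succ k ih =>
    rw [dsum_succ]
    have h1 := ih (fun t ht => hf t (by omega))
    have h2 : f k * M ^ k ≤ (M - 1) * M ^ k := Nat.mul_le_mul_right _ (hf k (by omega))
    have h3 : (M - 1) * M ^ k + M ^ k = M ^ (k + 1) := by
      rw [pow_succ]
      have : (M - 1) * M ^ k + M ^ k = (M - 1 + 1) * M ^ k := by ring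
      rw [this, Nat.sub_add_cancel hM, mul_comm]
    omega

/-- digits `≤ 2M-2` ⇒ `dsum + 2 ≤ 2 M^k` (needs `1 ≤ M`). -/
lemma dsum_add_two_le {M : ℕ} (hM : 1 ≤ M) (f : ℕ → ℕ) (k : ℕ) (hf : ∀ t < k, f t ≤ 2 * M - 2) :
    dsum M f k + 2 ≤ 2 * M ^ k := by
  induction k with
  | zero => simp [dsum]
  | succ k ih =>
    rw [dsum_succ]
    have h1 := ih (fun t ht => hf t (by omega))
    have h2 : f k * M ^ k ≤ (2 * M - 2) * M ^ k := Nat.mul_le_mul_right _ (hf k (by omega))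
    have h3 : (2 * M - 2) * M ^ k + 2 * M ^ k = 2 * M ^ (k + 1) := by
      rw [pow_succ]
      have : (2 * M - 2) * M ^ k + 2 * M ^ k = (2 * M - 2 + 2) * M ^ k := by ring
      rw [this]
      have : 2 * M - 2 + 2 = 2 * M := by omega
      rw [this]; ring
    omega

/-- truncation: `dsum M f d ≡ dsum M f k (mod M^k)` for `k ≤ d`. -/
lemma dsum_mod_pow (M : ℕ) (f : ℕ → ℕ) {k d : ℕ} (hkd : k ≤ d) :
    dsum M f d % M ^ k = dsum M f k % M ^ k := by
  have hsplit : dsum M f d = dsum M f k + ∑ t ∈ Ico k d, f t * M ^ t := by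
    simp only [dsum]; rw [← sum_range_add_sum_Ico _ hkd]
  have hdvd : M ^ k ∣ ∑ t ∈ Ico k d, f t * M ^ t := by
    apply dvd_sum
    intro t ht
    exact Dvd.dvd.mul_left (pow_dvd_pow M (mem_Ico.mp ht).1) _
  obtain ⟨q, hq⟩ := hdvd
  rw [hsplit, hq, Nat.add_mul_mod_self_left]

/-- **separation**: a digit vector `c` (digits `≤ 2M-2`) with a zero digit at `t₀ < d` and a
vector `z` with all digits in `[2, M-1]` have different digit sums (compare modulo `M^(t₀+1)`:
the `c`-side is `< 2M^t₀`, the `z`-side is `≥ 2M^t₀`). Needs `2 ≤ M`. -/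
lemma dsum_ne_of_zero_digit {M d t₀ : ℕ} (hM : 2 ≤ M) (ht₀ : t₀ < d) (c z : ℕ → ℕ)
    (hc : ∀ t < d, c t ≤ 2 * M - 2) (hc0 : c t₀ = 0) (hz : ∀ t < d, 2 ≤ z t ∧ z t ≤ M - 1) :
    dsum M c d ≠ dsum M z d := by
  intro heq
  have hmod : dsum M c d % M ^ (t₀ + 1) = dsum M z d % M ^ (t₀ + 1) := by rw [heq]
  rw [dsum_mod_pow M c (by omega : t₀ + 1 ≤ d), dsum_mod_pow M z (by omega : t₀ + 1 ≤ d),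
    dsum_succ, dsum_succ, hc0, zero_mul, add_zero] at hmod
  have hL : dsum M c t₀ + 2 ≤ 2 * M ^ t₀ :=
    dsum_add_two_le (by omega) c t₀ (fun t ht => hc t (by omega))
  have hR : dsum M z t₀ + z t₀ * M ^ t₀ < M ^ (t₀ + 1) := by
    have := dsum_lt_pow (M := M) (by omega) z (t₀ + 1) (fun t ht => (hz t (by omega)).2)
    rwa [dsum_succ] at this
  have hpow : 2 * M ^ t₀ ≤ M ^ (t₀ + 1) := by
    rw [pow_succ, mul_comm]; exact Nat.mul_le_mul_left _ hM
  have hLlt : dsum M c t₀ < M ^ (t₀ + 1) := by omega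
  rw [Nat.mod_eq_of_lt hLlt, Nat.mod_eq_of_lt hR] at hmod
  have hz2 : 2 * M ^ t₀ ≤ z t₀ * M ^ t₀ := Nat.mul_le_mul_right _ (hz t₀ ht₀).1
  omega

/-- **uniqueness of digits**: digit vectors with digits `< M` and equal digit sums agree below `d`. -/
lemma digits_eq_of_dsum_eq {M : ℕ} (hM : 1 ≤ M) :
    ∀ (d : ℕ) (x y : ℕ → ℕ), (∀ t < d, x t ≤ M - 1) → (∀ t < d, y t ≤ M - 1) →
      dsum M x d = dsum M y d → ∀ t < d, x t = y t := by
  intro d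
  induction d with
  | zero => intro x y _ _ _ t ht; omega
  | succ d ih =>
    intro x y hx hy heq t ht
    rw [dsum_succ, dsum_succ] at heq
    have hxd : dsum M x d < M ^ d := dsum_lt_pow hM x d (fun t ht => hx t (by omega))
    have hyd : dsum M y d < M ^ d := dsum_lt_pow hM y d (fun t ht => hy t (by omega))
    have hmod := congrArg (· % M ^ d) heq
    simp only [Nat.add_mul_mod_self_right, Nat.mod_eq_of_lt hxd, Nat.mod_eq_of_lt hyd] at hmod
    -- hmod : dsum M x d = dsum M y d
    have htop : x d * M ^ d = y d * M ^ d := by omega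
    have hMd : 0 < M ^ d := Nat.pos_of_ne_zero (pow_ne_zero d (by omega))
    rcases Nat.lt_succ_iff_lt_or_eq.mp ht with hlt | rfl
    · exact ih x y (fun t ht => hx t (by omega)) (fun t ht => hy t (by omega)) hmod t hlt
    · exact Nat.eq_of_mul_eq_mul_right hMd htop

/-- additivity of digit sums. -/
lemma dsum_add (M : ℕ) (f g : ℕ → ℕ) (k : ℕ) :
    dsum M (fun t => f t + g t) k = dsum M f k + dsum M g k := by
  simp [dsum, add_mul, sum_add_distrib]


/-! ## The radix-`M` digit design -/

section Design

variable (M d : ℕ)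

/-- extend a digit vector on `Fin d` by zero. -/
def ext (x : Fin d → ℕ) : ℕ → ℕ := fun t => if h : t < d then x ⟨t, h⟩ else 0

lemma ext_apply_fin (x : Fin d → ℕ) (t : Fin d) : ext d x t = x t := by
  simp [ext, t.isLt]

lemma ext_apply_lt (x : Fin d → ℕ) {t : ℕ} (ht : t < d) : ext d x t = x ⟨t, ht⟩ := by
  simp [ext, ht]

/-- value of a digit vector: `Σ_t x_t M^t`. -/
def val (x : Fin d → ℕ) : ℕ := dsum M (ext d x) d

/-- digit vectors supported on `S` with digits in `[2, M-1]` there. -/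
def boxA (S : Finset (Fin d)) : Finset (Fin d → ℕ) :=
  Fintype.piFinset (fun t => if t ∈ S then Icc 2 (M - 1) else {0})

/-- digit vectors supported off `S` with digits in `[2, M-1]` there. -/
def boxB (S : Finset (Fin d)) : Finset (Fin d → ℕ) :=
  Fintype.piFinset (fun t => if t ∈ S then {0} else Icc 2 (M - 1))

variable {M d}

lemma mem_boxA {S : Finset (Fin d)} {x : Fin d → ℕ} :
    x ∈ boxA M d S ↔ ∀ t, (t ∈ S → 2 ≤ x t ∧ x t ≤ M - 1) ∧ (t ∉ S → x t = 0) := by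
  simp only [boxA, Fintype.mem_piFinset]
  constructor
  · intro h t
    have := h t
    by_cases ht : t ∈ S
    · simp only [ht, if_true, mem_Icc] at this; exact ⟨fun _ => this, fun h' => (h' ht).elim⟩
    · simp only [ht, if_false, mem_singleton] at this; exact ⟨fun h' => (ht h').elim, fun _ => this⟩
  · intro h t
    by_cases ht : t ∈ S
    · simp only [ht, if_true, mem_Icc]; exact (h t).1 ht
    · simp only [ht, if_false, mem_singleton]; exact (h t).2 ht

lemma mem_boxB {S : Finset (Fin d)} {y : Fin d → ℕ} :
    y ∈ boxB M d S ↔ ∀ t, (t ∈ S → y t = 0) ∧ (t ∉ S → 2 ≤ y t ∧ y t ≤ M - 1) := by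
  simp only [boxB, Fintype.mem_piFinset]
  constructor
  · intro h t
    have := h t
    by_cases ht : t ∈ S
    · simp only [ht, if_true, mem_singleton] at this; exact ⟨fun _ => this, fun h' => (h' ht).elim⟩
    · simp only [ht, if_false, mem_Icc] at this; exact ⟨fun h' => (ht h').elim, fun _ => this⟩
  · intro h t
    by_cases ht : t ∈ S
    · simp only [ht, if_true, mem_singleton]; exact (h t).1 ht
    · simp only [ht, if_false, mem_Icc]; exact (h t).2 ht

/-- all digits of a box vector are `≤ M - 1`. -/
lemma digit_le_of_mem_boxA {S : Finset (Fin d)} {x : Fin d → ℕ} (hx : x ∈ boxA M d S) (t : Fin d) :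
    x t ≤ M - 1 := by
  rcases mem_boxA.mp hx t with ⟨h1, h2⟩
  by_cases ht : t ∈ S
  · exact (h1 ht).2
  · rw [h2 ht]; exact Nat.zero_le _

lemma digit_le_of_mem_boxB {S : Finset (Fin d)} {y : Fin d → ℕ} (hy : y ∈ boxB M d S) (t : Fin d) :
    y t ≤ M - 1 := by
  rcases mem_boxB.mp hy t with ⟨h1, h2⟩
  by_cases ht : t ∈ S
  · rw [h1 ht]; exact Nat.zero_le _
  · exact (h2 ht).2

lemma val_lt_pow (hM : 1 ≤ M) {x : Fin d → ℕ} (hx : ∀ t, x t ≤ M - 1) : val M d x < M ^ d := by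
  apply dsum_lt_pow hM
  intro t ht
  rw [ext_apply_lt d x ht]; exact hx _

/-- the digit-sum equation extracted from an SDPP relation between images in `ZMod p`. -/
lemma nat_rel_of_zmod_rel {p : ℕ} {xa xa' yb yb' : ℕ} (h1 : xa + yb' < p) (h2 : xa' + yb < p)
    (h : ((xa : ZMod p) - (xa' : ZMod p)) + (-(yb : ZMod p) - -(yb' : ZMod p)) = 0) :
    xa + yb' = xa' + yb := by
  have h' : ((xa + yb' : ℕ) : ZMod p) = ((xa' + yb : ℕ) : ZMod p) := by
    push_cast; linear_combination h
  have := (ZMod.natCast_eq_natCast_iff' _ _ p).mp h'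
  rwa [Nat.mod_eq_of_lt h1, Nat.mod_eq_of_lt h2] at this

/-- **(W)** for the digit design: `x + y' = x' + y` digitwise forces `x = x'`, `y = y'`. -/
lemma design_W (hM : 1 ≤ M) {S : Finset (Fin d)} {x x' y y' : Fin d → ℕ}
    (hx : x ∈ boxA M d S) (hx' : x' ∈ boxA M d S) (hy : y ∈ boxB M d S) (hy' : y' ∈ boxB M d S)
    (heq : val M d x + val M d y' = val M d x' + val M d y) : x = x' ∧ y = y' := by
  have hsum : dsum M (fun t => ext d x t + ext d y' t) d = dsum M (fun t => ext d x' t + ext d y t) d := by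
    rw [dsum_add, dsum_add]; exact heq
  have hdig : ∀ (u : Fin d → ℕ) (v : Fin d → ℕ), u ∈ boxA M d S → v ∈ boxB M d S →
      ∀ t < d, ext d u t + ext d v t ≤ M - 1 := by
    intro u v hu hv t ht
    rw [ext_apply_lt d u ht, ext_apply_lt d v ht]
    by_cases hts : (⟨t, ht⟩ : Fin d) ∈ S
    · rw [(mem_boxB.mp hv _).1 hts, add_zero]; exact ((mem_boxA.mp hu _).1 hts).2
    · rw [(mem_boxA.mp hu _).2 hts, zero_add]; exact ((mem_boxB.mp hv _).2 hts).2
  have hall := digits_eq_of_dsum_eq hM d _ _ (hdig x y' hx hy') (hdig x' y hx' hy) hsum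
  constructor
  · funext t
    have h := hall t.val t.isLt
    simp only [ext_apply_fin] at h
    by_cases hts : t ∈ S
    · rw [(mem_boxB.mp hy' _).1 hts, (mem_boxB.mp hy _).1 hts] at h; simpa using h
    · rw [(mem_boxA.mp hx _).2 hts, (mem_boxA.mp hx' _).2 hts]
  · funext t
    have h := hall t.val t.isLt
    simp only [ext_apply_fin] at h
    by_cases hts : t ∈ S
    · rw [(mem_boxB.mp hy' _).1 hts, (mem_boxB.mp hy _).1 hts]
    · rw [(mem_boxA.mp hx _).2 hts, (mem_boxA.mp hx' _).2 hts] at h; simpa using h.symm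


/-- **(X)** for the digit design: if `|S| = |V|` and `x + y' = x' + y` in value with
`x ∈ boxA S`, `x' ∈ boxA U`, `y ∈ boxB U`, `y' ∈ boxB V`, then `S = V` — otherwise some
`t₀ ∈ V ∖ S` is a zero digit of `x + y'` while `x' + y` has all digits in `[2, M-1]`. -/
lemma design_X (hM : 2 ≤ M) {S U V : Finset (Fin d)} (hSV : S.card = V.card)
    {x x' y y' : Fin d → ℕ} (hx : x ∈ boxA M d S) (hx' : x' ∈ boxA M d U)
    (hy : y ∈ boxB M d U) (hy' : y' ∈ boxB M d V)
    (heq : val M d x + val M d y' = val M d x' + val M d y) : S = V := by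
  by_contra hne
  have hex : ∃ t₀ ∈ V, t₀ ∉ S := by
    by_contra h
    push Not at h
    have hVS : V ⊆ S := fun t ht => h t ht
    exact hne (Finset.eq_of_subset_of_card_le hVS (by rw [hSV])).symm
  obtain ⟨t₀, ht₀V, ht₀S⟩ := hex
  have hsum : dsum M (fun t => ext d x t + ext d y' t) d =
      dsum M (fun t => ext d x' t + ext d y t) d := by
    rw [dsum_add, dsum_add]; exact heq
  refine dsum_ne_of_zero_digit hM t₀.isLt (fun t => ext d x t + ext d y' t)
    (fun t => ext d x' t + ext d y t) ?_ ?_ ?_ hsum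
  · intro t ht
    show ext d x t + ext d y' t ≤ 2 * M - 2
    rw [ext_apply_lt d x ht, ext_apply_lt d y' ht]
    have := digit_le_of_mem_boxA hx ⟨t, ht⟩
    have := digit_le_of_mem_boxB hy' ⟨t, ht⟩
    omega
  · show ext d x t₀ + ext d y' t₀ = 0
    rw [ext_apply_fin, ext_apply_fin, (mem_boxA.mp hx t₀).2 ht₀S, (mem_boxB.mp hy' t₀).1 ht₀V]
  · intro t ht
    show 2 ≤ ext d x' t + ext d y t ∧ ext d x' t + ext d y t ≤ M - 1
    rw [ext_apply_lt d x' ht, ext_apply_lt d y ht]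
    by_cases htU : (⟨t, ht⟩ : Fin d) ∈ U
    · rw [(mem_boxB.mp hy _).1 htU, add_zero]; exact (mem_boxA.mp hx' _).1 htU
    · rw [(mem_boxA.mp hx' _).2 htU, zero_add]; exact (mem_boxB.mp hy _).2 htU

/-- digit vectors with digits `≤ M-1` are determined by their value. -/
lemma eq_of_val_eq (hM : 1 ≤ M) {x x' : Fin d → ℕ} (hx : ∀ t, x t ≤ M - 1) (hx' : ∀ t, x' t ≤ M - 1)
    (h : val M d x = val M d x') : x = x' := by
  have hall := digits_eq_of_dsum_eq hM d (ext d x) (ext d x')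
    (fun t ht => by rw [ext_apply_lt d x ht]; exact hx _)
    (fun t ht => by rw [ext_apply_lt d x' ht]; exact hx' _) h
  funext t
  have := hall t.val t.isLt
  simpa [ext_apply_fin] using this

lemma card_boxA (S : Finset (Fin d)) : (boxA M d S).card = (M - 2) ^ S.card := by
  rw [boxA, Fintype.card_piFinset]
  have h : ∀ t : Fin d, (if t ∈ S then Icc 2 (M - 1) else ({0} : Finset ℕ)).card =
      if t ∈ S then M - 2 else 1 := by
    intro t; split_ifs
    · rw [Nat.card_Icc]; omega
    · simp
  simp_rw [h]
  rw [Finset.prod_ite_mem, Finset.univ_inter, Finset.prod_const]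

lemma card_boxB (S : Finset (Fin d)) : (boxB M d S).card = (M - 2) ^ (d - S.card) := by
  rw [boxB, Fintype.card_piFinset]
  have h : ∀ t : Fin d, (if t ∈ S then ({0} : Finset ℕ) else Icc 2 (M - 1)).card =
      if t ∈ Sᶜ then M - 2 else 1 := by
    intro t
    by_cases ht : t ∈ S
    · simp [ht]
    · rw [if_neg ht, if_pos (Finset.mem_compl.mpr ht), Nat.card_Icc]; omega
  simp_rw [h]
  rw [Finset.prod_ite_mem, Finset.univ_inter, Finset.prod_const, Finset.card_compl,
    Fintype.card_fin]

/-- **The radix-`M` digit design.** For `M ≥ 2`, `l`, and any `p ≥ 2·M^{2l}`, the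
`binom(2l,l)` pairs `A_S = {Σ_{t∈S} x_t M^t : x_t ∈ [2,M-1]}`, `B_S = {−Σ_{t∉S} y_t M^t : y_t ∈ [2,M-1]}`
(`S ⊆ Fin 2l`, `|S| = l`) form a balanced SDPP family in `ZMod p` with `s = (M-2)^l`. -/
theorem digit_design (M l p : ℕ) (hM : 2 ≤ M) (hp : 2 * M ^ (2 * l) ≤ p) :
    ∃ A B : Fin ((2 * l).choose l) → Finset (ZMod p),
      (∀ i, (A i).card = (M - 2) ^ l ∧ (B i).card = (M - 2) ^ l) ∧
      (∀ i, ∀ a ∈ A i, ∀ a' ∈ A i, ∀ b ∈ B i, ∀ b' ∈ B i,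
        (a - a') + (b - b') = 0 → a = a' ∧ b = b') ∧
      (∀ i j k, ∀ a ∈ A i, ∀ a' ∈ A j, ∀ b ∈ B j, ∀ b' ∈ B k,
        (a - a') + (b - b') = 0 → i = k) := by
  set d := 2 * l with hd
  -- index the l-subsets of Fin d by Fin (d.choose l)
  set P : Finset (Finset (Fin d)) := powersetCard l (univ : Finset (Fin d)) with hP
  have hcardP : Fintype.card {S // S ∈ P} = d.choose l := by
    rw [Fintype.card_coe, hP, Finset.card_powersetCard, Finset.card_univ, Fintype.card_fin]
  let e : Fin (d.choose l) ≃ {S // S ∈ P} := (Fintype.equivFinOfCardEq hcardP).symm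
  have hSl : ∀ i, ((e i).val).card = l := fun i =>
    (Finset.mem_powersetCard.mp (e i).property).2
  let f : (Fin d → ℕ) → ZMod p := fun x => ((val M d x : ℕ) : ZMod p)
  let g : (Fin d → ℕ) → ZMod p := fun y => -((val M d y : ℕ) : ZMod p)
  have hM1 : 1 ≤ M := by omega
  have hvalp : ∀ x : Fin d → ℕ, (∀ t, x t ≤ M - 1) → 2 * val M d x < p := fun x hx => by
    have := val_lt_pow (d := d) hM1 hx; omega
  refine ⟨fun i => (boxA M d (e i).val).image f, fun i => (boxB M d (e i).val).image g, ?_, ?_, ?_⟩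
  · -- cardinalities
    intro i
    constructor
    · rw [Finset.card_image_of_injOn, card_boxA, hSl]
      intro x hx x' hx' hxx
      have hxd := digit_le_of_mem_boxA (Finset.mem_coe.mp hx)
      have hxd' := digit_le_of_mem_boxA (Finset.mem_coe.mp hx')
      apply eq_of_val_eq hM1 hxd hxd'
      have := (ZMod.natCast_eq_natCast_iff' _ _ p).mp hxx
      rwa [Nat.mod_eq_of_lt (by have := hvalp x hxd; omega),
        Nat.mod_eq_of_lt (by have := hvalp x' hxd'; omega)] at this
    · rw [Finset.card_image_of_injOn, card_boxB, hSl]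
      · congr 1; omega
      intro y hy y' hy' hyy
      have hyd := digit_le_of_mem_boxB (Finset.mem_coe.mp hy)
      have hyd' := digit_le_of_mem_boxB (Finset.mem_coe.mp hy')
      apply eq_of_val_eq hM1 hyd hyd'
      have hyy' : ((val M d y : ℕ) : ZMod p) = ((val M d y' : ℕ) : ZMod p) := neg_injective hyy
      have := (ZMod.natCast_eq_natCast_iff' _ _ p).mp hyy'
      rwa [Nat.mod_eq_of_lt (by have := hvalp y hyd; omega),
        Nat.mod_eq_of_lt (by have := hvalp y' hyd'; omega)] at this
  · -- (W)
    intro i a ha a' ha' b hb b' hb' hab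
    simp only [Finset.mem_image] at ha ha' hb hb'
    obtain ⟨x, hx, rfl⟩ := ha
    obtain ⟨x', hx', rfl⟩ := ha'
    obtain ⟨y, hy, rfl⟩ := hb
    obtain ⟨y', hy', rfl⟩ := hb'
    have heq := nat_rel_of_zmod_rel
      (by have := hvalp x (digit_le_of_mem_boxA hx); have := hvalp y' (digit_le_of_mem_boxB hy'); omega)
      (by have := hvalp x' (digit_le_of_mem_boxA hx'); have := hvalp y (digit_le_of_mem_boxB hy); omega)
      hab
    obtain ⟨rfl, rfl⟩ := design_W hM1 hx hx' hy hy' heq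
    exact ⟨rfl, rfl⟩
  · -- (X)
    intro i j k a ha a' ha' b hb b' hb' hab
    simp only [Finset.mem_image] at ha ha' hb hb'
    obtain ⟨x, hx, rfl⟩ := ha
    obtain ⟨x', hx', rfl⟩ := ha'
    obtain ⟨y, hy, rfl⟩ := hb
    obtain ⟨y', hy', rfl⟩ := hb'
    have heq := nat_rel_of_zmod_rel
      (by have := hvalp x (digit_le_of_mem_boxA hx); have := hvalp y' (digit_le_of_mem_boxB hy'); omega)
      (by have := hvalp x' (digit_le_of_mem_boxA hx'); have := hvalp y (digit_le_of_mem_boxB hy); omega)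
      hab
    have hSV := design_X hM (by rw [hSl i, hSl k]) hx hx' hy hy' heq
    exact e.injective (Subtype.ext hSV)

end Design

/-! ## Corollaries -/

/-- `2^l ≤ binom(2l, l)`. -/
lemma two_pow_le_centralBinom (l : ℕ) : 2 ^ l ≤ Nat.centralBinom l := by
  induction l with
  | zero => simp
  | succ l ih =>
    have h := Nat.succ_mul_centralBinom_succ l
    -- (l+1) * C(l+1) = 2 * (2l+1) * C l ≥ 2 (l+1) C l
    have h2 : (l + 1) * (2 * Nat.centralBinom l) ≤ (l + 1) * Nat.centralBinom (l + 1) := by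
      rw [h]; nlinarith [Nat.centralBinom_pos l]
    have h3 : 2 * Nat.centralBinom l ≤ Nat.centralBinom (l + 1) :=
      Nat.le_of_mul_le_mul_left h2 (by omega)
    calc 2 ^ (l + 1) = 2 * 2 ^ l := by ring
      _ ≤ 2 * Nat.centralBinom l := by omega
      _ ≤ Nat.centralBinom (l + 1) := h3

open Summit.MatrixMultiplication.MatrixMultiplication.Theses in
/-- The matched-difference wall in prime cyclic groups is false: radix-9 digit designs have
`n·s² ≥ 98^l` inside `ZMod p`, `p ≤ 4·81^l`. -/
theorem not_primeCyclicWall : ¬ FourierTwoFamilies.PrimeCyclicWall := by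
  rintro ⟨C, h⟩
  set C' : ℝ := max C 1 with hC'
  have hC'1 : 1 ≤ C' := le_max_right _ _
  have hCC' : C ≤ C' := le_max_left _ _
  -- choose l with (98/81)^l > 4 C'
  set l : ℕ := ⌈81 * (4 * C') / 17⌉₊ + 1 with hl
  have hl_gt : 4 * C' < 1 + (l : ℝ) * (17 / 81) := by
    have : 81 * (4 * C') / 17 ≤ ⌈81 * (4 * C') / 17⌉₊ := Nat.le_ceil _
    have hl' : (l : ℝ) = (⌈81 * (4 * C') / 17⌉₊ : ℝ) + 1 := by rw [hl]; push_cast; ring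
    rw [hl']; nlinarith
  have hbern : 1 + (l : ℝ) * (17 / 81) ≤ (1 + 17 / 81) ^ l :=
    one_add_mul_le_pow (by norm_num) l
  have hgrow : 4 * C' * (81 : ℝ) ^ l < (98 : ℝ) ^ l := by
    have : (98 : ℝ) ^ l = (1 + 17 / 81) ^ l * 81 ^ l := by
      rw [← mul_pow]; norm_num
    rw [this]
    have h81 : (0 : ℝ) < 81 ^ l := by positivity
    nlinarith
  -- a Bertrand prime above 2·81^l
  obtain ⟨p, hp, hNp, hp4⟩ := Nat.exists_prime_lt_and_le_two_mul (2 * 9 ^ (2 * l)) (by positivity)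
  obtain ⟨A, B, hbal, hW, hX⟩ := digit_design 9 l p (by norm_num) (le_of_lt hNp)
  have key := h p hp ((2 * l).choose l) ((9 - 2) ^ l) A B hbal hW hX
  -- n ≥ 2^l, s² = 49^l, p ≤ 4·81^l
  have hn : (2 : ℝ) ^ l ≤ ((2 * l).choose l : ℕ) := by
    have := two_pow_le_centralBinom l
    rw [Nat.centralBinom] at this
    exact_mod_cast this
  have hs : (((9 - 2) ^ l : ℕ) : ℝ) ^ 2 = (49 : ℝ) ^ l := by
    push_cast; rw [← pow_mul, mul_comm, pow_mul]; norm_num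
  have hp_le : (p : ℝ) ≤ 4 * (81 : ℝ) ^ l := by
    have : p ≤ 4 * 9 ^ (2 * l) := by omega
    have h' : (9 : ℝ) ^ (2 * l) = 81 ^ l := by rw [pow_mul]; norm_num
    calc (p : ℝ) ≤ ((4 * 9 ^ (2 * l) : ℕ) : ℝ) := by exact_mod_cast this
      _ = 4 * 81 ^ l := by push_cast; rw [h']
  rw [hs] at key
  have h98 : (98 : ℝ) ^ l ≤ ((2 * l).choose l : ℕ) * (49 : ℝ) ^ l := by
    have : (98 : ℝ) ^ l = 2 ^ l * 49 ^ l := by rw [← mul_pow]; norm_num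
    rw [this]
    exact mul_le_mul_of_nonneg_right hn (by positivity)
  have hp0 : (0 : ℝ) ≤ p := by positivity
  have : C * (p : ℝ) ≤ C' * p := mul_le_mul_of_nonneg_right hCC' hp0
  nlinarith


open Summit.MatrixMultiplication.MatrixMultiplication.Theses in
/-- The gen-2 calibration item `WallBreachModP` (stmt-MatrixMultiplication-14315), positively:
for every `C` a prime `p` and a balanced SDPP configuration in `ZMod p` with `C·p < n·s²`
(radix-9 digit design at a Bertrand prime). -/
theorem wallBreachModP : FourierTwoFamiliesModP.WallBreachModP := by
  intro C
  set C' : ℝ := max C 1 with hC'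
  have hC'1 : 1 ≤ C' := le_max_right _ _
  set l : ℕ := ⌈81 * (4 * C') / 17⌉₊ + 1 with hl
  have hl_gt : 4 * C' < 1 + (l : ℝ) * (17 / 81) := by
    have : 81 * (4 * C') / 17 ≤ ⌈81 * (4 * C') / 17⌉₊ := Nat.le_ceil _
    have hl' : (l : ℝ) = (⌈81 * (4 * C') / 17⌉₊ : ℝ) + 1 := by rw [hl]; push_cast; ring
    rw [hl']; nlinarith
  have hbern : 1 + (l : ℝ) * (17 / 81) ≤ (1 + 17 / 81) ^ l := one_add_mul_le_pow (by norm_num) l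
  have hgrow : 4 * C' * (81 : ℝ) ^ l < (98 : ℝ) ^ l := by
    have : (98 : ℝ) ^ l = (1 + 17 / 81) ^ l * 81 ^ l := by rw [← mul_pow]; norm_num
    have h81 : (0 : ℝ) < 81 ^ l := by positivity
    rw [this]; nlinarith
  obtain ⟨p, hp, hNp, hp4⟩ := Nat.exists_prime_lt_and_le_two_mul (2 * 9 ^ (2 * l)) (by positivity)
  obtain ⟨A, B, hbal, hW, hX⟩ := digit_design 9 l p (by norm_num) (le_of_lt hNp)
  refine ⟨p, hp, (2 * l).choose l, (9 - 2) ^ l, A, B, hbal, hW, hX, ?_⟩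
  have hn : (2 : ℝ) ^ l ≤ ((2 * l).choose l : ℕ) := by
    have := two_pow_le_centralBinom l; rw [Nat.centralBinom] at this; exact_mod_cast this
  have hs : (((9 - 2) ^ l : ℕ) : ℝ) ^ 2 = (49 : ℝ) ^ l := by
    push_cast; rw [← pow_mul, mul_comm, pow_mul]; norm_num
  have hp_le : (p : ℝ) ≤ 4 * (81 : ℝ) ^ l := by
    have : p ≤ 4 * 9 ^ (2 * l) := by omega
    have h' : (9 : ℝ) ^ (2 * l) = 81 ^ l := by rw [pow_mul]; norm_num
    calc (p : ℝ) ≤ ((4 * 9 ^ (2 * l) : ℕ) : ℝ) := by exact_mod_cast this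
      _ = 4 * 81 ^ l := by push_cast; rw [h']
  rw [hs]
  have h98 : (98 : ℝ) ^ l ≤ ((2 * l).choose l : ℕ) * (49 : ℝ) ^ l := by
    have : (98 : ℝ) ^ l = 2 ^ l * 49 ^ l := by rw [← mul_pow]; norm_num
    rw [this]; exact mul_le_mul_of_nonneg_right hn (by positivity)
  have : C * (p : ℝ) ≤ C' * p := mul_le_mul_of_nonneg_right (le_max_left _ _) (by positivity)
  nlinarith

/-- **Sharp calibration of the crux exponent.** If `81 < 4·7^{1+c}` (i.e. `c > log(81/28)/log 7
≈ 0.5459`) then the power saving `n·s^{1+c} ≤ p` FAILS for balanced SDPP configurations in prime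
cyclic groups with arbitrarily large `s`: the radix-9 digit design has `n = binom(2l,l) ≥ 4^l/(2l)`,
`s = 7^l`, and lives in `ZMod p` with `p ≤ 4·81^l`, so `n·s^{1+c}/p ≥ θ^l/(8l)` with
`θ = 4·7^{1+c}/81 > 1`, which exceeds `1` for `l = 2k`, `k > 16/(θ-1)²` (Bernoulli squared). -/
theorem not_powerGain_of_large {c : ℝ} (hc : (81 : ℝ) < 4 * (7 : ℝ) ^ (1 + c)) (s₀ : ℕ) :
    ¬ (∀ p : ℕ, p.Prime → ∀ (n s : ℕ) (A B : Fin n → Finset (ZMod p)), s₀ ≤ s →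
      (∀ i : Fin n, (A i).card = s ∧ (B i).card = s) →
      (∀ i : Fin n, ∀ a ∈ A i, ∀ a' ∈ A i, ∀ b ∈ B i, ∀ b' ∈ B i,
        (a - a') + (b - b') = 0 → a = a' ∧ b = b') →
      (∀ i j k : Fin n, ∀ a ∈ A i, ∀ a' ∈ A j, ∀ b ∈ B j, ∀ b' ∈ B k,
        (a - a') + (b - b') = 0 → i = k) →
      (n : ℝ) * (s : ℝ) ^ (1 + c) ≤ (p : ℝ)) := by
  intro h
  set θ : ℝ := 4 * (7 : ℝ) ^ (1 + c) / 81 with hθ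
  have hθ1 : 1 < θ := by rw [hθ, lt_div_iff₀ (by norm_num : (0:ℝ) < 81)]; linarith
  have h7pos : (0 : ℝ) < (7 : ℝ) ^ (1 + c) := by positivity
  -- k with k (θ-1)² > 16 and k ≥ s₀ ; l = 2k
  set k : ℕ := max (⌈16 / (θ - 1) ^ 2⌉₊ + 1) (max s₀ 1) with hk
  have hk1 : 1 ≤ k := le_trans (le_max_right _ _) (le_max_right _ _)
  have hks₀ : s₀ ≤ k := le_trans (le_max_left _ _) (le_max_right _ _)
  have hk16 : 16 < (k : ℝ) * (θ - 1) ^ 2 := by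
    have hpos : 0 < (θ - 1) ^ 2 := by nlinarith
    have : 16 / (θ - 1) ^ 2 < k := by
      have h1 : 16 / (θ - 1) ^ 2 ≤ ⌈16 / (θ - 1) ^ 2⌉₊ := Nat.le_ceil _
      have h2 : (⌈16 / (θ - 1) ^ 2⌉₊ + 1 : ℕ) ≤ k := le_max_left _ _
      have h3 : ((⌈16 / (θ - 1) ^ 2⌉₊ + 1 : ℕ) : ℝ) ≤ k := by exact_mod_cast h2
      push_cast at h3; linarith
    rwa [div_lt_iff₀ hpos] at this
  set l : ℕ := 2 * k with hl
  -- the design at a Bertrand prime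
  obtain ⟨p, hp, hNp, hp4⟩ := Nat.exists_prime_lt_and_le_two_mul (2 * 9 ^ (2 * l)) (by positivity)
  obtain ⟨A, B, hbal, hW, hX⟩ := digit_design 9 l p (by norm_num) (le_of_lt hNp)
  have hs₀ : s₀ ≤ (9 - 2) ^ l := by
    have : l ≤ 7 ^ l := le_of_lt (Nat.lt_pow_self (by norm_num))
    have : k ≤ l := by omega
    simp only [show (9:ℕ) - 2 = 7 from rfl]; omega
  have key := h p hp ((2 * l).choose l) ((9 - 2) ^ l) A B hs₀ hbal hW hX
  -- numerics: 2l·n ≥ 4^l, s^(1+c) = (7^(1+c))^l, p ≤ 4·81^l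
  have hl0 : 0 < l := by omega
  have hn : (4 : ℝ) ^ l ≤ 2 * l * ((2 * l).choose l : ℕ) := by
    have := Nat.four_pow_le_two_mul_self_mul_centralBinom l hl0
    rw [Nat.centralBinom] at this; exact_mod_cast this
  have hs : (((9 - 2) ^ l : ℕ) : ℝ) ^ (1 + c) = ((7 : ℝ) ^ (1 + c)) ^ l := by
    push_cast
    rw [← Real.rpow_natCast (7 : ℝ) l,
      ← Real.rpow_mul (by norm_num), mul_comm, Real.rpow_mul_natCast (by norm_num)]
  have hp_le : (p : ℝ) ≤ 4 * (81 : ℝ) ^ l := by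
    have : p ≤ 4 * 9 ^ (2 * l) := by omega
    have h' : (9 : ℝ) ^ (2 * l) = 81 ^ l := by rw [pow_mul]; norm_num
    calc (p : ℝ) ≤ ((4 * 9 ^ (2 * l) : ℕ) : ℝ) := by exact_mod_cast this
      _ = 4 * 81 ^ l := by push_cast; rw [h']
  rw [hs] at key
  -- θ^l = (θ^k)^2 ≥ (1 + k(θ-1))^2 > 16 k = 8 l
  have hbern : 1 + (k : ℝ) * (θ - 1) ≤ θ ^ k := by
    have := one_add_mul_le_pow (show (-2 : ℝ) ≤ θ - 1 by linarith) k
    simpa using this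
  have hθl : 8 * (l : ℝ) < θ ^ l := by
    have : θ ^ l = (θ ^ k) ^ 2 := by rw [hl, pow_mul']
    rw [this]
    have h1 : 0 ≤ 1 + (k : ℝ) * (θ - 1) := by positivity
    have h2 : (1 + (k : ℝ) * (θ - 1)) ^ 2 ≤ (θ ^ k) ^ 2 := pow_le_pow_left₀ h1 hbern 2
    have h3 : (l : ℝ) = 2 * k := by rw [hl]; push_cast; ring
    rw [h3]; nlinarith
  -- combine: 2l · n · (7^(1+c))^l ≥ 4^l (7^(1+c))^l = (81 θ)^l = 81^l θ^l > 81^l · 8 l ≥ 2 l p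
  have h81θ : (4 : ℝ) ^ l * ((7 : ℝ) ^ (1 + c)) ^ l = (81 : ℝ) ^ l * θ ^ l := by
    rw [← mul_pow, ← mul_pow]; congr 1; rw [hθ]; field_simp
  have hpow7 : (0 : ℝ) < ((7 : ℝ) ^ (1 + c)) ^ l := by positivity
  have h81 : (0 : ℝ) < (81 : ℝ) ^ l := by positivity
  have hl_pos : (0 : ℝ) < l := by exact_mod_cast hl0
  -- from key: n * (7^(1+c))^l ≤ p ≤ 4·81^l ; multiply by 2l
  have c1 : 2 * (l : ℝ) * (((2 * l).choose l : ℕ) * ((7 : ℝ) ^ (1 + c)) ^ l) ≤ 2 * l * (4 * 81 ^ l) := by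
    exact mul_le_mul_of_nonneg_left (le_trans key hp_le) (by positivity)
  have c2 : (4 : ℝ) ^ l * ((7 : ℝ) ^ (1 + c)) ^ l ≤ 2 * (l : ℝ) * (((2 * l).choose l : ℕ) * ((7 : ℝ) ^ (1 + c)) ^ l) := by
    have := mul_le_mul_of_nonneg_right hn (le_of_lt hpow7)
    linarith [this]
  rw [h81θ] at c2
  -- 81^l θ^l ≤ 8 l 81^l  contradicts θ^l > 8l
  have c3 : (81 : ℝ) ^ l * θ ^ l ≤ (81 : ℝ) ^ l * (8 * l) := by nlinarith
  have c4 : θ ^ l ≤ 8 * l := le_of_mul_le_mul_left c3 h81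
  linarith


/-! ## Numeration powers of SDPP families (CKSU Lemma 21, cyclic form) -/

section Power

open Literature.Computability.AlgebraicComplexity

/-- From `(a − a') + (b − b') = 0` in `ZMod q` to `a + b = a' + b'` in `ℕ`, all sums `< q`. -/
lemma nat_add_eq_of_sub_add_sub {q xa xa' xb xb' : ℕ} (h1 : xa + xb < q) (h2 : xa' + xb' < q)
    (h : ((xa : ZMod q) - (xa' : ZMod q)) + ((xb : ZMod q) - (xb' : ZMod q)) = 0) :
    xa + xb = xa' + xb' := by
  rw [sub_add_sub_comm, sub_eq_zero] at h
  have h' : ((xa + xb : ℕ) : ZMod q) = ((xa' + xb' : ℕ) : ZMod q) := by push_cast; exact h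
  have := (ZMod.natCast_eq_natCast_iff' _ _ q).mp h'
  rwa [Nat.mod_eq_of_lt h1, Nat.mod_eq_of_lt h2] at this

/-- **Numeration power.** The `k`-th power of an SDPP family in `ZMod p` (words `w : Fin k → Fin n`,
`A_w = {Σ_t (x_t).val·(2p)^t : x_t ∈ A (w t)}`, same for `B`) is an SDPP family in `ZMod q` for every
`q ≥ 2·(2p)^k`, with `|A_w| = ∏ |A (w t)|` (radix `2p` makes every digit sum carry-free). -/
theorem numeration_power {p : ℕ} (hp : 0 < p) {n k : ℕ} (A B : Fin n → Finset (ZMod p))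
    (h : IsSDPP A B) {q : ℕ} (hq : 2 * (2 * p) ^ k ≤ q) :
    ∃ A' B' : Fin (n ^ k) → Finset (ZMod q), IsSDPP A' B' ∧
      ∀ i, ∃ w : Fin k → Fin n, (A' i).card = ∏ t, (A (w t)).card ∧ (B' i).card = ∏ t, (B (w t)).card := by
  haveI : NeZero p := ⟨hp.ne'⟩
  set R := 2 * p with hR
  have hR1 : 1 ≤ R := by omega
  have hcard : Fintype.card (Fin k → Fin n) = n ^ k := by simp
  let e : Fin (n ^ k) ≃ (Fin k → Fin n) := (Fintype.equivFinOfCardEq hcard).symm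
  -- digit vectors of a word of elements, and their encoding
  let dg : (Fin k → ZMod p) → (Fin k → ℕ) := fun x t => (x t).val
  let enc : (Fin k → ZMod p) → ZMod q := fun x => ((val R k (dg x) : ℕ) : ZMod q)
  have hdg : ∀ (x : Fin k → ZMod p) (t : Fin k), dg x t ≤ R - 1 := fun x t => by
    have := ZMod.val_lt (x t); simp only [dg]; omega
  have hval : ∀ x : Fin k → ZMod p, 2 * val R k (dg x) < q := fun x => by
    have := val_lt_pow (d := k) hR1 (hdg x); omega
  -- the coordinatewise relation extracted from a relation between encodings
  have transfer : ∀ xa xa' xb xb' : Fin k → ZMod p,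
      (enc xa - enc xa') + (enc xb - enc xb') = 0 →
      ∀ t : Fin k, (xa t - xa' t) + (xb t - xb' t) = 0 := by
    intro xa xa' xb xb' hrel t
    have hnat := nat_add_eq_of_sub_add_sub
      (by have := hval xa; have := hval xb; omega) (by have := hval xa'; have := hval xb'; omega) hrel
    have hsum : dsum R (fun u => ext k (dg xa) u + ext k (dg xb) u) k =
        dsum R (fun u => ext k (dg xa') u + ext k (dg xb') u) k := by
      rw [dsum_add, dsum_add]; exact hnat
    have hdig : ∀ (x y : Fin k → ZMod p), ∀ u < k, ext k (dg x) u + ext k (dg y) u ≤ R - 1 := by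
      intro x y u hu
      rw [ext_apply_lt k _ hu, ext_apply_lt k _ hu]
      have := ZMod.val_lt (x ⟨u, hu⟩); have := ZMod.val_lt (y ⟨u, hu⟩)
      simp only [dg]; omega
    have hall := digits_eq_of_dsum_eq hR1 k _ _ (hdig xa xb) (hdig xa' xb') hsum t.val t.isLt
    simp only [ext_apply_fin, dg] at hall
    -- hall : (xa t).val + (xb t).val = (xa' t).val + (xb' t).val
    have hc := congrArg (fun m : ℕ => (m : ZMod p)) hall
    simp only [Nat.cast_add, ZMod.natCast_val, ZMod.cast_id', id_eq] at hc
    rw [sub_add_sub_comm, sub_eq_zero]; exact hc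
  have hinj : ∀ x x' : Fin k → ZMod p, enc x = enc x' → x = x' := by
    intro x x' hxx
    have hn : val R k (dg x) = val R k (dg x') := by
      have := (ZMod.natCast_eq_natCast_iff' _ _ q).mp hxx
      rwa [Nat.mod_eq_of_lt (by have := hval x; omega),
        Nat.mod_eq_of_lt (by have := hval x'; omega)] at this
    have := eq_of_val_eq hR1 (hdg x) (hdg x') hn
    funext t
    exact ZMod.val_injective p (congrFun this t)
  refine ⟨fun i => (Fintype.piFinset fun t => A (e i t)).image enc,
    fun i => (Fintype.piFinset fun t => B (e i t)).image enc, ⟨?_, ?_⟩, ?_⟩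
  · intro i a ha a' ha' b hb b' hb' hab
    simp only [Finset.mem_image, Fintype.mem_piFinset] at ha ha' hb hb'
    obtain ⟨xa, hxa, rfl⟩ := ha; obtain ⟨xa', hxa', rfl⟩ := ha'
    obtain ⟨xb, hxb, rfl⟩ := hb; obtain ⟨xb', hxb', rfl⟩ := hb'
    have hco := transfer xa xa' xb xb' hab
    have h1 : xa = xa' := funext fun t => (h.1 (e i t) _ (hxa t) _ (hxa' t) _ (hxb t) _ (hxb' t) (hco t)).1
    have h2 : xb = xb' := funext fun t => (h.1 (e i t) _ (hxa t) _ (hxa' t) _ (hxb t) _ (hxb' t) (hco t)).2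
    exact ⟨by rw [h1], by rw [h2]⟩
  · intro i j l a ha a' ha' b hb b' hb' hab
    simp only [Finset.mem_image, Fintype.mem_piFinset] at ha ha' hb hb'
    obtain ⟨xa, hxa, rfl⟩ := ha; obtain ⟨xa', hxa', rfl⟩ := ha'
    obtain ⟨xb, hxb, rfl⟩ := hb; obtain ⟨xb', hxb', rfl⟩ := hb'
    have hco := transfer xa xa' xb xb' hab
    apply e.injective
    funext t
    exact h.2 (e i t) (e j t) (e l t) _ (hxa t) _ (hxa' t) _ (hxb t) _ (hxb' t) (hco t)
  · intro i
    refine ⟨e i, ?_, ?_⟩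
    · rw [Finset.card_image_of_injective _ (fun x x' hh => hinj x x' hh), Fintype.card_piFinset]
    · rw [Finset.card_image_of_injective _ (fun x x' hh => hinj x x' hh), Fintype.card_piFinset]

end Power

open Summit.MatrixMultiplication.MatrixMultiplication.Theses Literature.Computability.AlgebraicComplexity in
/-- **Threshold-free form of the crux.** `PrimeCyclicPowerGain` holds iff some `c > 0` gives
`n·s^{1+c} ≤ 8p` for ALL balanced SDPP configurations (no `s ≥ s₀`): numeration powers push any
design past the threshold (`k = s₀ + 1`: `(n·s^{1+c})^k ≤ q ≤ 4(2p)^k ≤ (8p)^k`), and conversely the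
constant `8` is absorbed by `c ↦ c/2`, `s₀ = ⌈64^{1/c}⌉`. -/
theorem primeCyclicPowerGain_iff_thresholdFree :
    FourierTwoFamiliesModP.PrimeCyclicPowerGain ↔
    ∃ c : ℝ, 0 < c ∧ ∀ p : ℕ, p.Prime → ∀ (n s : ℕ) (A B : Fin n → Finset (ZMod p)),
      (∀ i : Fin n, (A i).card = s ∧ (B i).card = s) → IsSDPP A B →
      (n : ℝ) * (s : ℝ) ^ (1 + c) ≤ 8 * (p : ℝ) := by
  constructor
  · rintro ⟨c, hc, s₀, h⟩
    refine ⟨c, hc, fun p hp n s A B hbal hS => ?_⟩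
    have hp0 : (0 : ℝ) < p := by exact_mod_cast hp.pos
    rcases Nat.lt_or_ge s 2 with hs2 | hs2
    · -- s ≤ 1 : n·s^{1+c} ≤ n·1 ≤ p  (s = 1: disjointness; s = 0: trivial)
      interval_cases s
      · simp [Real.zero_rpow (by linarith : (1 + c) ≠ 0)]
      · simp only [Nat.cast_one, Real.one_rpow, mul_one]
        haveI : NeZero p := ⟨hp.ne_zero⟩
        have hne : ∀ i : Fin n, (B i).Nonempty := fun i => by
          rw [← Finset.card_pos, (hbal i).2]; exact Nat.one_pos
        have := hS.sum_card_left_le hne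
        simp only [fun i => (hbal i).1, Finset.sum_const, Finset.card_univ, Fintype.card_fin,
          smul_eq_mul, mul_one, ZMod.card] at this
        have : (n : ℝ) ≤ p := by exact_mod_cast this
        linarith
    · -- s ≥ 2: take the (s₀+1)-th numeration power at a Bertrand prime q ∈ (2(2p)^k, 4(2p)^k]
      set k := s₀ + 1 with hk
      have hk1 : 1 ≤ k := by omega
      obtain ⟨q, hq, hq1, hq2⟩ :=
        Nat.exists_prime_lt_and_le_two_mul (2 * (2 * p) ^ k) (by have := hp.pos; positivity)
      obtain ⟨A', B', hS', hcard'⟩ := numeration_power hp.pos A B hS (le_of_lt hq1)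
      have hbal' : ∀ i, (A' i).card = s ^ k ∧ (B' i).card = s ^ k := fun i => by
        obtain ⟨w, h1, h2⟩ := hcard' i
        rw [h1, h2]
        simp only [fun t => (hbal (w t)).1, fun t => (hbal (w t)).2, Finset.prod_const,
          Finset.card_univ, Fintype.card_fin, and_self]
      have hs₀ : s₀ ≤ s ^ k := by
        have : k ≤ 2 ^ k := le_of_lt (Nat.lt_two_pow_self)
        have : 2 ^ k ≤ s ^ k := Nat.pow_le_pow_left hs2 k
        omega
      have key := h q hq (n ^ k) (s ^ k) A' B' hs₀ hbal' hS'.1 hS'.2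
      -- (n s^{1+c})^k ≤ q ≤ 4 (2p)^k ≤ (8p)^k
      have hs_pos : (0 : ℝ) < s := by exact_mod_cast (by omega : 0 < s)
      have hpow : ((s ^ k : ℕ) : ℝ) ^ (1 + c) = ((s : ℝ) ^ (1 + c)) ^ k := by
        push_cast
        rw [← Real.rpow_natCast (s : ℝ) k, ← Real.rpow_mul hs_pos.le, mul_comm,
          Real.rpow_mul_natCast hs_pos.le]
      rw [hpow] at key
      push_cast at key
      have hq_le : (q : ℝ) ≤ (8 * p) ^ k := by
        have h1 : (q : ℝ) ≤ 4 * (2 * p) ^ k := by exact_mod_cast (by omega : q ≤ 4 * (2 * p) ^ k)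
        have h2 : (4 : ℝ) * (2 * p) ^ k ≤ (8 * p) ^ k := by
          have : ((8 : ℝ) * p) ^ k = 4 ^ k * (2 * p) ^ k := by rw [← mul_pow]; ring
          rw [this]
          have h4 : (4 : ℝ) ≤ 4 ^ k := by
            calc (4 : ℝ) = 4 ^ 1 := by norm_num
              _ ≤ 4 ^ k := pow_le_pow_right₀ (by norm_num) hk1
          have : (0 : ℝ) ≤ (2 * p) ^ k := by positivity
          nlinarith
        linarith
      have hprod : ((n : ℝ) * (s : ℝ) ^ (1 + c)) ^ k ≤ ((8 : ℝ) * p) ^ k := by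
        rw [mul_pow]; linarith
      exact le_of_pow_le_pow_left₀ (by omega) (by positivity) hprod
  · rintro ⟨c, hc, h⟩
    have hc2 : 0 < c / 2 := by linarith
    refine ⟨c / 2, hc2, ⌈(8 : ℝ) ^ ((c / 2)⁻¹)⌉₊, fun p hp n s A B hs hbal hW hX => ?_⟩
    have key := h p hp n s A B hbal ⟨hW, hX⟩
    have h8 : (8 : ℝ) ≤ (s : ℝ) ^ (c / 2) := by
      have h1 : (8 : ℝ) ^ ((c / 2)⁻¹) ≤ s := le_trans (Nat.le_ceil _) (by exact_mod_cast hs)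
      have h2 := Real.rpow_le_rpow (by positivity) h1 hc2.le
      rwa [Real.rpow_inv_rpow (by norm_num) hc2.ne'] at h2
    have hs_pos : (0 : ℝ) < s := by
      have : (0 : ℝ) < (s : ℝ) ^ (c / 2) := by linarith
      rcases Nat.eq_zero_or_pos s with h0 | h0
      · subst h0; simp [Real.zero_rpow hc2.ne'] at this
      · exact_mod_cast h0
    have hsplit : (s : ℝ) ^ (1 + c) = (s : ℝ) ^ (1 + c / 2) * (s : ℝ) ^ (c / 2) := by
      rw [← Real.rpow_add hs_pos]; ring_nf
    rw [hsplit] at key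
    have hx : 0 ≤ (n : ℝ) * (s : ℝ) ^ (1 + c / 2) := by positivity
    nlinarith [mul_le_mul_of_nonneg_left h8 hx]

end Digit


/-- (c2) for the crux's own `PowerGainAt`: no exponent with `81 < 4·7^{1+c}` (`c > 0.5459…`). -/
theorem not_powerGainAt_of_large {c : ℝ} (hc : (81 : ℝ) < 4 * (7 : ℝ) ^ (1 + c)) (s₀ : ℕ) :
    ¬ PowerGainAt c s₀ :=
  fun h => Digit.not_powerGain_of_large hc s₀ (fun p hp n s A B hs hb hW hX => h p hp n s A B hs hb hW hX)

/-! ## (c4) The all-abelian benchmark: CKSU Prop. 24 in `(ZMod 3)^{2l}` (what CyclicReduction would import)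

The torus design has density `(8/9)^l/√(πl) ≈ s^{-0.1699}`; so the all-abelian gen-1 item
`FourierTwoFamilies.BalancedPowerGain` can only hold for `c < 0.1699`, and the gap between the cyclic
floor `-0.546` of numeration designs and the torus `-0.1699` is the (16/9)^l-per-level price of the
excluded digits `0, 1`. -/

namespace Torus

open Finset

variable (d : ℕ)

/-- vectors supported exactly on `S` (nonzero entries in `ZMod 3`). -/
def tA (S : Finset (Fin d)) : Finset (Fin d → ZMod 3) :=
  Fintype.piFinset (fun t => if t ∈ S then ({1, 2} : Finset (ZMod 3)) else {0})

/-- `B_S = A_{Sᶜ}`: vectors supported exactly off `S`. -/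
def tB (S : Finset (Fin d)) : Finset (Fin d → ZMod 3) :=
  Fintype.piFinset (fun t => if t ∈ S then ({0} : Finset (ZMod 3)) else {1, 2})

variable {d}

lemma aux12 (z : ZMod 3) : z ∈ ({1, 2} : Finset (ZMod 3)) ↔ z ≠ 0 := by revert z; decide

lemma mem_tA {S : Finset (Fin d)} {x : Fin d → ZMod 3} :
    x ∈ tA d S ↔ ∀ t, (t ∈ S → x t ≠ 0) ∧ (t ∉ S → x t = 0) := by
  simp only [tA, Fintype.mem_piFinset]
  constructor
  · intro h t
    have ht' := h t
    by_cases ht : t ∈ S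
    · rw [if_pos ht, aux12] at ht'; exact ⟨fun _ => ht', fun hn => (hn ht).elim⟩
    · rw [if_neg ht, Finset.mem_singleton] at ht'; exact ⟨fun hs => (ht hs).elim, fun _ => ht'⟩
  · intro h t
    by_cases ht : t ∈ S
    · rw [if_pos ht, aux12]; exact (h t).1 ht
    · rw [if_neg ht, Finset.mem_singleton]; exact (h t).2 ht

lemma mem_tB {S : Finset (Fin d)} {y : Fin d → ZMod 3} :
    y ∈ tB d S ↔ ∀ t, (t ∈ S → y t = 0) ∧ (t ∉ S → y t ≠ 0) := by
  simp only [tB, Fintype.mem_piFinset]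
  constructor
  · intro h t
    have ht' := h t
    by_cases ht : t ∈ S
    · rw [if_pos ht, Finset.mem_singleton] at ht'; exact ⟨fun _ => ht', fun hn => (hn ht).elim⟩
    · rw [if_neg ht, aux12] at ht'; exact ⟨fun hs => (ht hs).elim, fun _ => ht'⟩
  · intro h t
    by_cases ht : t ∈ S
    · rw [if_pos ht, Finset.mem_singleton]; exact (h t).1 ht
    · rw [if_neg ht, aux12]; exact (h t).2 ht

lemma card_tA (S : Finset (Fin d)) : (tA d S).card = 2 ^ S.card := by
  rw [tA, Fintype.card_piFinset]
  have h : ∀ t : Fin d, (if t ∈ S then ({1, 2} : Finset (ZMod 3)) else {0}).card =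
      if t ∈ S then 2 else 1 := by intro t; split_ifs <;> decide
  simp_rw [h]; rw [Finset.prod_ite_mem, Finset.univ_inter, Finset.prod_const]

lemma card_tB (S : Finset (Fin d)) : (tB d S).card = 2 ^ (d - S.card) := by
  rw [tB, Fintype.card_piFinset]
  have h : ∀ t : Fin d, (if t ∈ S then ({0} : Finset (ZMod 3)) else {1, 2}).card =
      if t ∈ Sᶜ then 2 else 1 := by
    intro t; by_cases ht : t ∈ S
    · simp [ht]
    · rw [if_neg ht, if_pos (Finset.mem_compl.mpr ht)]; decide
  simp_rw [h]
  rw [Finset.prod_ite_mem, Finset.univ_inter, Finset.prod_const, Finset.card_compl, Fintype.card_fin]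

/-- **CKSU Prop. 24** (torus design): the `binom(2l,l)` pairs `(A_S, B_S = A_{Sᶜ})`, `|S| = l`, of
vectors in `(ZMod 3)^{2l}` supported exactly on `S` / off `S`, form a balanced SDPP family with
`s = 2^l` in a group of order `9^l`. -/
theorem torus_design (l : ℕ) :
    ∃ A B : Fin ((2 * l).choose l) → Finset (Fin (2 * l) → ZMod 3),
      (∀ i, (A i).card = 2 ^ l ∧ (B i).card = 2 ^ l) ∧
      (∀ i, ∀ a ∈ A i, ∀ a' ∈ A i, ∀ b ∈ B i, ∀ b' ∈ B i,
        (a - a') + (b - b') = 0 → a = a' ∧ b = b') ∧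
      (∀ i j k, ∀ a ∈ A i, ∀ a' ∈ A j, ∀ b ∈ B j, ∀ b' ∈ B k,
        (a - a') + (b - b') = 0 → i = k) := by
  set d := 2 * l with hd
  set P : Finset (Finset (Fin d)) := powersetCard l (univ : Finset (Fin d)) with hP
  have hcardP : Fintype.card {S // S ∈ P} = d.choose l := by
    rw [Fintype.card_coe, hP, Finset.card_powersetCard, Finset.card_univ, Fintype.card_fin]
  let e : Fin (d.choose l) ≃ {S // S ∈ P} := (Fintype.equivFinOfCardEq hcardP).symm
  have hSl : ∀ i, ((e i).val).card = l := fun i => (Finset.mem_powersetCard.mp (e i).property).2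
  refine ⟨fun i => tA d (e i).val, fun i => tB d (e i).val, fun i => ?_, ?_, ?_⟩
  · rw [card_tA, card_tB, hSl]; constructor <;> congr 1; omega
  · intro i a ha a' ha' b hb b' hb' hab
    have hco : ∀ t, (a t - a' t) + (b t - b' t) = 0 := fun t => by
      have := congrFun hab t; simpa using this
    constructor
    · funext t
      by_cases ht : t ∈ (e i).val
      · have h1 := (mem_tB.mp hb t).1 ht; have h2 := (mem_tB.mp hb' t).1 ht
        have := hco t; rw [h1, h2, sub_zero, add_zero, sub_eq_zero] at this; exact this
      · rw [(mem_tA.mp ha t).2 ht, (mem_tA.mp ha' t).2 ht]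
    · funext t
      by_cases ht : t ∈ (e i).val
      · rw [(mem_tB.mp hb t).1 ht, (mem_tB.mp hb' t).1 ht]
      · have h1 := (mem_tA.mp ha t).2 ht; have h2 := (mem_tA.mp ha' t).2 ht
        have := hco t; rw [h1, h2, sub_zero, zero_add, sub_eq_zero] at this; exact this
  · intro i j k a ha a' ha' b hb b' hb' hab
    by_contra hik
    -- a coordinate t₀ ∈ V \ S, V = e k, S = e i
    have hne : (e i).val ≠ (e k).val := fun h => hik (e.injective (Subtype.ext h))
    have hex : ∃ t₀ ∈ (e k).val, t₀ ∉ (e i).val := by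
      by_contra h
      push Not at h
      exact hne (Finset.eq_of_subset_of_card_le (fun t ht => h t ht) (by rw [hSl, hSl])).symm
    obtain ⟨t₀, ht₀V, ht₀S⟩ := hex
    have hco : (a t₀ - a' t₀) + (b t₀ - b' t₀) = 0 := by
      have := congrFun hab t₀; simpa using this
    rw [(mem_tA.mp ha t₀).2 ht₀S, (mem_tB.mp hb' t₀).1 ht₀V, zero_sub, sub_zero,
      neg_add_eq_sub, sub_eq_zero] at hco
    -- hco : b t₀ = a' t₀ with a' ∈ A_U, b ∈ B_U
    by_cases htU : t₀ ∈ (e j).val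
    · exact (mem_tA.mp ha' t₀).1 htU (hco ▸ (mem_tB.mp hb t₀).1 htU)
    · exact (mem_tB.mp hb t₀).2 htU (hco.trans ((mem_tA.mp ha' t₀).2 htU))

/-- `2l·binom(2l,l) ≥ 4^l` recast: the all-abelian power saving fails for `9 < 4·2^{1+c}`, i.e.
`c > log₂(9/4) - 1 ≈ 0.1699`, already in the groups `(ZMod 3)^{2l}` (CKSU Prop. 24). -/
theorem not_balancedPowerGain_of_large {c : ℝ} (hc : (9 : ℝ) < 4 * (2 : ℝ) ^ (1 + c)) (s₀ : ℕ) :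
    ¬ (∀ (H : Type) [AddCommGroup H] [Fintype H] (n s : ℕ) (A B : Fin n → Finset H), s₀ ≤ s →
      (∀ i : Fin n, (A i).card = s ∧ (B i).card = s) →
      (∀ i : Fin n, ∀ a ∈ A i, ∀ a' ∈ A i, ∀ b ∈ B i, ∀ b' ∈ B i,
        (a - a') + (b - b') = 0 → a = a' ∧ b = b') →
      (∀ i j k : Fin n, ∀ a ∈ A i, ∀ a' ∈ A j, ∀ b ∈ B j, ∀ b' ∈ B k,
        (a - a') + (b - b') = 0 → i = k) →
      (n : ℝ) * (s : ℝ) ^ (1 + c) ≤ (Fintype.card H : ℝ)) := by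
  intro h
  set θ : ℝ := 4 * (2 : ℝ) ^ (1 + c) / 9 with hθ
  have hθ1 : 1 < θ := by rw [hθ, lt_div_iff₀ (by norm_num : (0:ℝ) < 9)]; linarith
  set k : ℕ := max (⌈4 / (θ - 1) ^ 2⌉₊ + 1) (max s₀ 1) with hk
  have hk1 : 1 ≤ k := le_trans (le_max_right _ _) (le_max_right _ _)
  have hks₀ : s₀ ≤ k := le_trans (le_max_left _ _) (le_max_right _ _)
  have hk4 : 4 < (k : ℝ) * (θ - 1) ^ 2 := by
    have hpos : 0 < (θ - 1) ^ 2 := by nlinarith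
    have : 4 / (θ - 1) ^ 2 < k := by
      have h1 : 4 / (θ - 1) ^ 2 ≤ ⌈4 / (θ - 1) ^ 2⌉₊ := Nat.le_ceil _
      have h3 : ((⌈4 / (θ - 1) ^ 2⌉₊ + 1 : ℕ) : ℝ) ≤ k := by exact_mod_cast le_max_left _ _
      push_cast at h3; linarith
    rwa [div_lt_iff₀ hpos] at this
  set l : ℕ := 2 * k with hl
  obtain ⟨A, B, hbal, hW, hX⟩ := torus_design l
  have hs₀ : s₀ ≤ 2 ^ l := by
    have : l ≤ 2 ^ l := le_of_lt (Nat.lt_two_pow_self); omega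
  have key := h (Fin (2 * l) → ZMod 3) ((2 * l).choose l) (2 ^ l) A B hs₀ hbal hW hX
  have hcardH : (Fintype.card (Fin (2 * l) → ZMod 3) : ℝ) = (9 : ℝ) ^ l := by
    rw [Fintype.card_fun, ZMod.card, Fintype.card_fin]; push_cast; rw [pow_mul]; norm_num
  rw [hcardH] at key
  have hl0 : 0 < l := by omega
  have hn : (4 : ℝ) ^ l ≤ 2 * l * ((2 * l).choose l : ℕ) := by
    have := Nat.four_pow_le_two_mul_self_mul_centralBinom l hl0
    rw [Nat.centralBinom] at this; exact_mod_cast this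
  have hs : (((2 : ℕ) ^ l : ℕ) : ℝ) ^ (1 + c) = ((2 : ℝ) ^ (1 + c)) ^ l := by
    push_cast
    rw [← Real.rpow_natCast (2 : ℝ) l, ← Real.rpow_mul (by norm_num), mul_comm,
      Real.rpow_mul_natCast (by norm_num)]
  rw [hs] at key
  have hbern : 1 + (k : ℝ) * (θ - 1) ≤ θ ^ k := by
    have := one_add_mul_le_pow (show (-2 : ℝ) ≤ θ - 1 by linarith) k; simpa using this
  have hθl : 2 * (l : ℝ) < θ ^ l := by
    have : θ ^ l = (θ ^ k) ^ 2 := by rw [hl, pow_mul']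
    rw [this]
    have h1 : 0 ≤ 1 + (k : ℝ) * (θ - 1) := by positivity
    have h2 : (1 + (k : ℝ) * (θ - 1)) ^ 2 ≤ (θ ^ k) ^ 2 := pow_le_pow_left₀ h1 hbern 2
    have h3 : (l : ℝ) = 2 * k := by rw [hl]; push_cast; ring
    rw [h3]; nlinarith
  have h9θ : (4 : ℝ) ^ l * ((2 : ℝ) ^ (1 + c)) ^ l = (9 : ℝ) ^ l * θ ^ l := by
    rw [← mul_pow, ← mul_pow]; congr 1; rw [hθ]; field_simp
  have hpow2 : (0 : ℝ) < ((2 : ℝ) ^ (1 + c)) ^ l := by positivity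
  have h9 : (0 : ℝ) < (9 : ℝ) ^ l := by positivity
  have c1 : 2 * (l : ℝ) * (((2 * l).choose l : ℕ) * ((2 : ℝ) ^ (1 + c)) ^ l) ≤ 2 * l * 9 ^ l :=
    mul_le_mul_of_nonneg_left key (by positivity)
  have c2 : (4 : ℝ) ^ l * ((2 : ℝ) ^ (1 + c)) ^ l ≤
      2 * (l : ℝ) * (((2 * l).choose l : ℕ) * ((2 : ℝ) ^ (1 + c)) ^ l) := by
    have := mul_le_mul_of_nonneg_right hn (le_of_lt hpow2); linarith
  rw [h9θ] at c2
  have c3 : (9 : ℝ) ^ l * θ ^ l ≤ (9 : ℝ) ^ l * (2 * l) := by nlinarith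
  have c4 : θ ^ l ≤ 2 * l := le_of_mul_le_mul_left c3 h9
  linarith

end Torus

/-! ## (e) Near-miss: the crux itself -/

/-- NEAR-MISS (sorried on purpose; this is the crux).  What a kill needs: for EVERY `c > 0`, balanced
SDPP designs in some `ZMod N` (primality is irrelevant, `primeCyclicPowerGain_iff_cyclicPowerGain`;
a single design with `n·s^{1+c} > 16N` suffices by tensoring + Bertrand lifting) of density
`ns/N > s^{-c}`.  Best known (this file): `s^{-0.546}` (radix-9 digits); the torus `(ℤ/3)^{2l}` reaches
`s^{-0.17}` but every known transfer to cyclic hosts loses a factor `≥ (16/9)^l`; density `s^{-o(1)}`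
in ANY abelian group is CKSU Prop. 25 tightness — open since 2005.  Obstructions proved here that any
witness must respect: more than `s^{1-c}` translation classes of pairs (`translate_wall`); (W) and the
three-index part of (X) both essential.  Tried: see the module docblock's dead-end list. -/
theorem primeCyclicPowerGain_refuted : ¬ PrimeCyclicPowerGain := by
  sorry

end Summit.MatrixMultiplication.MatrixMultiplication.Cruxes.PrimeCyclicPowerGain.Disproof
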